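import Literature.Probability.RandomPlanarGeometry.HexSAWSurfaceWallRenewalSeventhExact
import Literature.Probability.RandomPlanarGeometry.HexSAWSurfaceWallRenewalSixthExact
import HarnessLib

/-!
# The renewal mean, the visit mean and the contact density of the adsorbed honeycomb walk to SEVENTH order:
# `m(y) = 1 + 2/y² + 3/y³ + 11/y⁴ + 30/y⁵ + 73/y⁶ + 211/y⁷ + o(y⁻⁷)`, `V(y) = 1 + 1/y⁴ + 3/y⁵ + 7/y⁶ + 21/y⁷ + o(y⁻⁷)`,
# `½ − ρ(log y) = 1/y² + 3/(2y³) + 3/y⁴ + 15/(2y⁵) + 23/(2y⁶) + 49/(2y⁷) + o(y⁻⁷)`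

Topic `Literature/Probability/RandomPlanarGeometry` (lane «pcv-sawmu», a-p6 g20, car «SEVENTH-EXACT-MEAN»; parents, all TREE: own «SIXTH-EXACT-MEAN»
`HexSAWSurfaceWallRenewalSixthExact` (the order-six template §3–§9: `hasSum_excess_tail_fourteen`, `hasSum_visitExcess_twenty`, the tower rungs
`A, Q, P`, the sixth-order pure forms `→ 73`, `→ 7`, `→ 23/2`), own «A6-EXACT» `HexSAWSurfaceWallRenewalSeventhExact` (hence, transitively,
a-idea-1 g34's «SEVEN-CENSUS» `HexSAWSurfaceWallRenewalCensusSeven`: `Λ₁₆ = 38y + 11y²`, `Λ₁₈ = N₉,₁y + 34y² + y³`, `Λ₂₀ = N₁₀,₁y + N₁₀,₂y² + 7y³`,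
the thirty-four two-visit eighteens `EighteenTwo.W`, the seven three-visit twenties `TwentyThree.W`; a-idea-1 g33's six-step law `six_mul_visits_le`;
the fifth-order window `tendsto_pow_four_mul_wallRate_sq_sub`); the renewal–reward identity `pwbMean_sub_pwbVisitMean_eq` («VISIT-EXCESS»)).

Objects (all TREE, def-free here): `β(y) = wallRate y`, the block laws `f_s(y) = pwbLaw y s = Λ_{2s}(y)/β^{2s}`, the renewal mean `m(y) = pwbMean y
= Σ_s s f_s`, the visit-weighted block polynomial `Λ^v_n = IPWBV n`, the visit mean `V(y) = pwbVisitMean y`, the surface contact densities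
`ρ^±(t) = wallRightDensity t / wallLeftDensity t` of wall bridges at fugacity `y = eᵗ` [MadrasSlade1993, Section 4.2, (4.2.2)–(4.2.5), Theorem 4.2.2
(pp. 91–92)], [Kesten1963SAW, Section 4], [BeatonBousquetMelouDeGierDuminilCopinGuttmann2014, Section 3.1 (arXiv v5 pp. 8–10)], [Giacomin2011,
Chapter 2, (2.9)–(2.11)].

## What is proved (namespace `…SAW.HexBW.Wall`; block lengths symbolic)
* §1 ★ the fifth tower rung `tendsto_pow_five_mul_one_sub_div_sub : y⁵(1 − y/β²) − y³ − y² − y → 2` (from `a₄ = 4`).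
* §2 laws at order seven: `visits_le_half_sub_eight` (`visits ≤ n/2 − 8` on `ipwb n`, `n ≥ 22`, SIX-STEP), `IPWB_le_card_mul_pow_eight`,
  ★ `pwbLaw_le_nine_pow_div_pow_eight : f_s ≤ 9^s/y⁸` (`s ≥ 11`), `head_ten_mul_pwbLaw_le` (`10f₁₁ + … + 14f₁₅ ≤ 3213797076676908/y⁸`),
  ★ `eight_mul_pwbLaw_nine_le_seven` / `div_le_eight_mul_pwbLaw_nine` (`8f₉` two-sided about `(272y² + 8y³)/β¹⁸`), ★ `nine_mul_pwbLaw_ten_le_seven` /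
  `div_le_nine_mul_pwbLaw_ten` (`9f₁₀` two-sided about `63y³/β²⁰`), `hasSum_excess_tail_sixteen`, ★ `excess_tail_sixteen_le (48 ≤ y) :
  m − 1 − (2f₃ + … + 14f₁₅) ≤ 32μ³⁴/(y⁷√y)`, ★★ `lower_seven_pwbMean` / `upper_seven_pwbMean`.
* §3 ★★★ **`tendsto_pow_seven_mul_pwbMean_sub : y⁷ (m − 1 − 2y/β⁶ − 3y/β⁸ − 12y/β¹⁰ − (30y + 5y²)/β¹² − (90y + 18y²)/β¹⁴ − (266y + 77y²)/β¹⁶ −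
  8y³/β¹⁸) → 335 = 8·N₉,₂ + 9·N₁₀,₃ = 8·34 + 9·7`** (`tendsto_pow_ten_div_wallRate_pow_twenty`, `eventually_pow_seven_mul_pwbMean_mem`).
* §4 the seven term-wise seventh-order corrections (`tendsto_pow_seven_mul_two_mul_div_sub` `→ 0`, `…three_mul_div_sub` `→ 6`, `…twelve_mul_div_sub`
  `→ −60`, `…twelves_sub` `→ −210`, `…fourteens_sub` `→ −126`, `…sixteens_sub` `→ 266`, `…eight_cube_div_sub` `→ 0`; each an exact polynomial
  identity in the tower `A, Q, P, H` and `u = 1/y`, checked by `ring`) and ★★★ **`tendsto_pow_seven_mul_pwbMean_sub_six_terms :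
  y⁷ (m − 1 − 2/y² − 3/y³ − 11/y⁴ − 30/y⁵ − 73/y⁶) → 211`**, `isEquivalent_pwbMean_sub_six_terms` — **`m₇ = 211`**; the pure form needs `β²` only
  through `4/y⁴` two-sided.
* Part II: §5 `IPWBV_sub_IPWB_twenty : Λ^v₂₀ − Λ₂₀ = N₁₀,₂·y² + 14y³`, `IPWBV_sub_IPWB_le_of_twentytwo_le`, `visitExcess_term_le_nine_pow_eight`,
  `hasSum_visitExcess_twentytwo`, ★★ `pwbVisitMean_sub_one_ge_seven` / `pwbVisitMean_sub_one_le_seven (48 ≤ y)`; §6 ★★★ **`tendsto_pow_seven_mul_pwbVisitMean_sub :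
  y⁷(V − 1 − y²/β¹² − 3y²/β¹⁴ − 11y²/β¹⁶ − (34y² + 2y³)/β¹⁸) → 14 = 2·N₁₀,₃`**, the four visit-term corrections (`→ −6, −21, 0, 34`),
  ★★★ **`tendsto_pow_seven_mul_pwbVisitMean_sub_one_sub : y⁷(V − 1 − 1/y⁴ − 3/y⁵ − 7/y⁶) → 21`** (**`V₇ = 21`**), `isEquivalent_pwbVisitMean_sub_one_sub_seven`;
  §7 ★★★ **`tendsto_pow_seven_mul_density_deficit : y⁷(½ − ρ⁺(log y) − 1/y² − 3/(2y³) − 3/y⁴ − 15/(2y⁵) − 23/(2y⁶)) → 49/2`**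
  (`49/2 = (211 − 21 − 2·30 − 3·11 − 6·3 − 15·2 − 23·0)/2`), `…_left`, ★★ `tendsto_exp_seven_mul_deficit` (`t`-form), `isEquivalent_density_deficit_seventh`.

METHOD.  The order-six template one order up, with two new inputs: (i) the COMPLETE census of the diagonal `s − v ≤ 7` (cars 63–72) makes every
block of half-length `≤ 8` explicit and gives `8f₉ ≥ (272y² + 8y³)/β¹⁸`, `9f₁₀ ≥ 63y³/β²⁰` with crude-count remainders `O(y⁻⁸)`; (ii) the six-step law
bounds the census-unknown half-lengths `11 ≤ s ≤ 15` by `f_s ≤ 9^s/y⁸` (`visits ≤ s − 8`), and the envelope `f_s ≤ μ²√y (μ²/√y)^s` the tail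
`s ≥ 16` by `32μ³⁴/(y⁷√y)` (`y ≥ 48`).  The pure-power conversions are exact polynomial identities in the `β²`-tower (`r = y/β²`, `A = y²(1 − r) → 1`,
`Q = y³(1 − r) − y → 1`, `P = y⁴(1 − r) − y² − y → 1`, `H = y⁵(1 − r) − y³ − y² − y → 2`) and `u = 1/y`: only `a₄ = 4` enters `m₇`, `V₇`, `d₇`
(the seventh coefficient `a₆ = 12` of «A6-EXACT» is NOT used here — consistent with FINDING-HEX-WALL-RENEWAL-CENSUS §4).  Target constants certified
beforehand by exact rational arithmetic (a-p6 g19 `a6_check.py`: `m₇ = 211`, `V₇ = 21`; this seat's `work/m7/m7_terms.py`, `tower.py`: the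
term-wise constants and `d₇ = 49/2`; lit-1 g26/g27 desk faces; ref g67's second code).

HONEST LABEL.  LANE THEOREM for this model, DERIVED (assembly of the landed census chain and the lane's renewal toolkit); the printed sources carry
the renewal structure (M–S §4.2, Kesten §4), the renewal–reward identity (Giacomin (2.11)) and the first-order statements only — the coefficients
`211`, `21`, `49/2` (like the lower orders before them) are computed in this lane: NEW IN WRITING (modest), not quotations.  NOT CLAIMED: `N₉,₁`,
`N₁₀,₁`, `N₁₀,₂` (data `98`, `267`, `99`: order `y⁻⁸`); anything at order `y⁻⁸`; anything for `y ≤ μ⁴` (the two-sided bounds are stated on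
`y > μ⁴` / `y ≥ 48`, where the tree's `√y`-envelope lives; the limits are at `y → ∞`); the armchair wall; numerics.  No definitions.
-/

namespace Literature.Probability.RandomPlanarGeometry.SAW.HexBW.Wall

open Finset Filter Function
open Literature.Probability.LatticeModels
open _root_.Topology Asymptotics

variable {y : ℝ} {n : ℕ} {ω : ℕ → Site 2}

/-! ### §0  Private helpers -/

/-- `μ² = 2 + √2`. [cite: DuminilCopinSmirnov2012, Theorem 1] -/
private theorem mu_sq_sm : hexConnectiveConstant ^ 2 = 2 + Real.sqrt 2 := by
  rw [hexConnectiveConstant_eq_inv, inv_pow]; exact inv_eq_of_mul_eq_one_right hexCriticalFugacity_sq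

/-- `4 ≤ μ⁴`. [cite: DuminilCopinSmirnov2012, Theorem 1] -/
private theorem four_le_mu_four_sm : 4 ≤ hexConnectiveConstant ^ 4 := by
  have h2 : 0 ≤ Real.sqrt 2 := Real.sqrt_nonneg 2
  calc (4 : ℝ) ≤ (2 + Real.sqrt 2) ^ 2 := by nlinarith
    _ = hexConnectiveConstant ^ 4 := by rw [← mu_sq_sm]; ring

/-- `μ⁴ < 12`. [cite: DuminilCopinSmirnov2012, Theorem 1] -/
private theorem mu_four_lt_twelve_sm : hexConnectiveConstant ^ 4 < 12 := by
  have hup : Real.sqrt 2 ≤ 1.41422 := by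
    rw [Real.sqrt_le_left (by norm_num)]
    norm_num
  have h2 : 0 ≤ Real.sqrt 2 := Real.sqrt_nonneg 2
  calc hexConnectiveConstant ^ 4 = (2 + Real.sqrt 2) ^ 2 := by rw [← mu_sq_sm]; ring
    _ ≤ (2 + 1.41422) ^ 2 := by gcongr
    _ < 12 := by norm_num

/-- `y ≤ β(y)²` for `y > 0`. [cite: BeatonBousquetMelouDeGierDuminilCopinGuttmann2014, Section 3.1, Proposition 5 (arXiv v5 p. 9)] -/
private theorem le_sq_wallRate_sm (hy : 0 < y) : y ≤ wallRate y ^ 2 := by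
  have h := pow_le_pow_left₀ (Real.sqrt_nonneg y) (sqrt_le_wallRate hy) 2
  rwa [Real.sq_sqrt hy.le] at h

/-- `y^k ≤ β(y)^{2k}` for `y > 0`. [cite: BeatonBousquetMelouDeGierDuminilCopinGuttmann2014, Section 3.1, Proposition 5 (arXiv v5 p. 9)] -/
private theorem pow_le_wallRate_pow_sm (hy : 0 < y) (k : ℕ) : y ^ k ≤ wallRate y ^ (2 * k) := by
  rw [pow_mul]; exact pow_le_pow_left₀ hy.le (le_sq_wallRate_sm hy) k

/-- [folklore] Relabel the limit of a `Tendsto` by an equal constant. -/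
private theorem tendsto_of_tendsto_of_eq_sm {f : ℝ → ℝ} {L c : ℝ} (h : Tendsto f atTop (𝓝 L)) (e : L = c) :
    Tendsto f atTop (𝓝 c) := e ▸ h

/-- `θ = μ²/√y ≤ ½` once `y ≥ 48`. [cite: MadrasSlade1993, Section 4.2, remark before (4.2.21) (p. 94)] [cite: DuminilCopinSmirnov2012, Theorem 1] -/
private theorem theta_le_half_sm (hy : 48 ≤ y) : hexConnectiveConstant ^ 2 / Real.sqrt y ≤ 1 / 2 := by
  have hy0 : 0 < y := by linarith
  have hs0 : 0 < Real.sqrt y := Real.sqrt_pos.2 hy0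
  have hy2 : Real.sqrt y ^ 2 = y := Real.sq_sqrt hy0.le
  have h4 : (2 * hexConnectiveConstant ^ 2) ^ 2 ≤ Real.sqrt y ^ 2 := by
    rw [hy2]
    have e : (2 * hexConnectiveConstant ^ 2) ^ 2 = 4 * hexConnectiveConstant ^ 4 := by ring
    rw [e]
    have := mu_four_lt_twelve_sm
    linarith
  have h2 : 2 * hexConnectiveConstant ^ 2 ≤ Real.sqrt y :=
    (pow_le_pow_iff_left₀ (by positivity) hs0.le two_ne_zero).1 h4
  rw [div_le_iff₀ hs0]
  linarith

/-- `m(y) → 1`. [cite: MadrasSlade1993, Section 4.2, Theorem 4.2.2 (pp. 91–92)] -/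
private theorem tendsto_pwbMean_sm : Tendsto pwbMean atTop (𝓝 1) := by
  have h0 : Tendsto (fun y : ℝ => y ^ 2 * (pwbMean y - 1) * (y ^ 2)⁻¹) atTop (𝓝 (2 * 0)) :=
    tendsto_sq_mul_pwbMean_sub_one.mul (tendsto_pow_atTop two_ne_zero).inv_tendsto_atTop
  have h1 : Tendsto (fun y : ℝ => y ^ 2 * (pwbMean y - 1) * (y ^ 2)⁻¹ + 1) atTop (𝓝 (2 * 0 + 1)) := h0.add_const 1
  rw [mul_zero, zero_add] at h1
  refine h1.congr' ?_
  filter_upwards [eventually_gt_atTop (0 : ℝ)] with y hy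
  field_simp
  ring

/-- `y·(m(y) − 1) → 0`. [cite: MadrasSlade1993, Section 4.2, Theorem 4.2.2 (pp. 91–92)] -/
private theorem tendsto_mul_pwbMean_sub_one_sm : Tendsto (fun y : ℝ => y * (pwbMean y - 1)) atTop (𝓝 0) := by
  have h := tendsto_sq_mul_pwbMean_sub_one.mul tendsto_inv_atTop_zero
  rw [mul_zero] at h
  refine h.congr' ?_
  filter_upwards [eventually_gt_atTop (0 : ℝ)] with y hy
  field_simp

/-! ### §1  The fifth rung of the `β²`-tower: `y⁵(1 − y/β²) − y³ − y² − y → 2` (from the exact fifth order `a₄ = 4`) -/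

/-- ★ **`y⁵ (1 − y/β(y)²) − y³ − y² − y → 2`**, i.e. `1 − y/β² = 1/y² + 1/y³ + 1/y⁴ + 2/y⁵ + o(y⁻⁵)` — from the fifth-order window
`y⁴(β² − y − 1/y − 1/y² − 2/y³) → 4` («FIFTH-ORDER-UPPER»/«-LOWER») by the identity `H = D₄·r − P/y − A − 2A/y − 1`
(`r = y/β²`, `A = y²(1 − r) → 1`, `P = y⁴(1 − r) − y² − y → 1`, `D₄ → 4`).
[cite: BeatonBousquetMelouDeGierDuminilCopinGuttmann2014, Section 3.1, Proposition 5 (arXiv v5 p. 9) and p. 10] -/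
theorem tendsto_pow_five_mul_one_sub_div_sub :
    Tendsto (fun y : ℝ => y ^ 5 * (1 - y / wallRate y ^ 2) - y ^ 3 - y ^ 2 - y) atTop (𝓝 2) := by
  have hr := tendsto_div_wallRate_sq
  have hA := tendsto_sq_mul_one_sub_div_wallRate_sq
  have hP := tendsto_pow_four_mul_one_sub_div_sub
  have hD := tendsto_pow_four_mul_wallRate_sq_sub
  have hu : Tendsto (fun y : ℝ => y⁻¹) atTop (𝓝 0) := tendsto_inv_atTop_zero
  have h := ((((hD.mul hr).sub (hP.mul hu)).sub hA).sub ((hA.mul hu).const_mul 2)).sub_const 1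
  refine Tendsto.congr' ?_ (tendsto_of_tendsto_of_eq_sm h (by norm_num))
  filter_upwards [eventually_gt_atTop (0 : ℝ)] with y hy
  have hw : wallRate y ≠ 0 := (wallRate_pos y).ne'
  have hy' : y ≠ 0 := hy.ne'
  field_simp
  ring

/-! ### §2  Laws at order seven: `8f₉`, `9f₁₀` two-sided, the crude bound from half-length eleven on, the tail beyond fifteen -/

/-- ★ **`visits ≤ n/2 − 8` on `ipwb n` for `n ≥ 22`** — the six-step law `6·visits ≤ n` («SIX-STEP») in the form used for the crude
order-seven bounds (`⌊s/3⌋ ≤ s − 8` for `s ≥ 11`). [cite: MadrasSlade1993, Section 4.2, remark before (4.2.21) (p. 94)] -/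
theorem visits_le_half_sub_eight (hn : 22 ≤ n) (hω : ω ∈ ipwb n) : visits n ω ≤ n / 2 - 8 := by
  have h6 := six_mul_visits_le hω (by omega)
  omega

/-- `Λ_n(y) ≤ #(ipwb n)·y^{n/2 − 8}` for `n ≥ 22`, `y ≥ 1`. [cite: MadrasSlade1993, Section 4.2, (4.2.2) (p. 91)] -/
theorem IPWB_le_card_mul_pow_eight (hn : 22 ≤ n) (hy : 1 ≤ y) : IPWB n y ≤ #(ipwb n) * y ^ (n / 2 - 8) := by
  rw [IPWB]
  have h := Finset.sum_le_card_nsmul (ipwb n) (fun ω => y ^ visits n ω) (y ^ (n / 2 - 8)) fun ω hω =>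
    pow_le_pow_right₀ hy (visits_le_half_sub_eight hn hω)
  rwa [nsmul_eq_mul] at h

/-- ★ **`f_s(y) ≤ 9^s/y⁸` for `s ≥ 11`, `y ≥ 1`** (`#(ipwb 2s) ≤ 3^{2s}`, `visits ≤ s − 8`, `β^{2s} ≥ y^s`).
[cite: MadrasSlade1993, Section 1.2, (1.2.3); Section 4.2, (4.2.2), (4.2.4) (p. 91)] -/
theorem pwbLaw_le_nine_pow_div_pow_eight {s : ℕ} (hs : 11 ≤ s) (hy : 1 ≤ y) : pwbLaw y s ≤ 9 ^ s / y ^ 8 := by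
  have hy0 : 0 < y := by linarith
  obtain ⟨m, hm⟩ : ∃ m : ℕ, m = 2 * s := ⟨_, rfl⟩
  have e : pwbLaw y s = IPWB m y / wallRate y ^ m := by rw [pwbLaw, hm]
  rw [e]
  have hden : y ^ s ≤ wallRate y ^ m := by rw [hm]; exact pow_le_wallRate_pow_sm hy0 s
  have hc : (#(ipwb m) : ℝ) ≤ 9 ^ s := by
    calc (#(ipwb m) : ℝ) ≤ 3 ^ m := card_ipwb_le_three_pow m
      _ = 9 ^ s := by rw [hm, pow_mul]; norm_num
  calc IPWB m y / wallRate y ^ m ≤ #(ipwb m) * y ^ (m / 2 - 8) / wallRate y ^ m :=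
        div_le_div_of_nonneg_right (IPWB_le_card_mul_pow_eight (by omega) hy) (pow_nonneg (wallRate_pos y).le m)
    _ ≤ #(ipwb m) * y ^ (m / 2 - 8) / y ^ s := div_le_div_of_nonneg_left (by positivity) (by positivity) hden
    _ = #(ipwb m) / y ^ 8 := by
        rw [show m / 2 - 8 = s - 8 by omega, div_eq_div_iff (by positivity) (by positivity)]
        rw [show (#(ipwb m) : ℝ) * y ^ (s - 8) * y ^ 8 = #(ipwb m) * (y ^ (s - 8) * y ^ 8) by ring, ← pow_add,
          show s - 8 + 8 = s by omega]
    _ ≤ 9 ^ s / y ^ 8 := div_le_div_of_nonneg_right hc (by positivity)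

/-- ★ **The census-unknown head terms from half-length eleven to fifteen are `O(y⁻⁸)`**:
`10f₁₁ + 11f₁₂ + 12f₁₃ + 13f₁₄ + 14f₁₅ ≤ 3213797076676908/y⁸` (`= Σ_{s=11}^{15} (s − 1)9^s`), `y ≥ 1`.
[cite: MadrasSlade1993, Section 4.2, (4.2.2)–(4.2.5) (p. 91)] -/
theorem head_ten_mul_pwbLaw_le (hy : 1 ≤ y) :
    10 * pwbLaw y 11 + 11 * pwbLaw y 12 + 12 * pwbLaw y 13 + 13 * pwbLaw y 14 + 14 * pwbLaw y 15 ≤ 3213797076676908 / y ^ 8 := by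
  have hy0 : 0 < y := by linarith
  have h11 := pwbLaw_le_nine_pow_div_pow_eight (s := 11) (by norm_num) hy
  have h12 := pwbLaw_le_nine_pow_div_pow_eight (s := 12) (by norm_num) hy
  have h13 := pwbLaw_le_nine_pow_div_pow_eight (s := 13) (by norm_num) hy
  have h14 := pwbLaw_le_nine_pow_div_pow_eight (s := 14) (by norm_num) hy
  have h15 := pwbLaw_le_nine_pow_div_pow_eight (s := 15) (by norm_num) hy
  have e : (3213797076676908 : ℝ) / y ^ 8 =
      10 * (9 ^ 11 / y ^ 8) + 11 * (9 ^ 12 / y ^ 8) + 12 * (9 ^ 13 / y ^ 8) + 13 * (9 ^ 14 / y ^ 8) + 14 * (9 ^ 15 / y ^ 8) := by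
    norm_num; ring
  rw [e]
  linarith

open Classical in
/-- ★ **`8f₉` two-sided**: `(272y² + 8y³)/β¹⁸ ≤ 8f₉(y) ≤ (272y² + 8y³)/β¹⁸ + 3099363912/y⁸` (`y ≥ 1` for the upper bound; `Λ₁₈ = N₉,₁y + 34y² + y³`
with `N₉,₁ ≤ 3¹⁸`, `β¹⁸ ≥ y⁹`; «SEVEN-CENSUS»). [cite: MadrasSlade1993, Section 1.2, (1.2.3); Section 4.2, (4.2.2)–(4.2.5) (p. 91)] [cite: Kesten1963SAW, Section 4] -/
theorem eight_mul_pwbLaw_nine_le_seven (hy : 1 ≤ y) : 8 * pwbLaw y 9 ≤ (272 * y ^ 2 + 8 * y ^ 3) / wallRate y ^ 18 + 3099363912 / y ^ 8 := by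
  have hy0 : 0 < y := by linarith
  obtain ⟨m, hm⟩ : ∃ m : ℕ, m = 18 := ⟨_, rfl⟩
  have e : pwbLaw y 9 = IPWB m y / wallRate y ^ m := by rw [pwbLaw, hm]
  have h18 : wallRate y ^ m = wallRate y ^ 18 := by rw [hm]
  rw [e, IPWB_eighteen_eq hm, h18]
  have hN : (#((ipwb m).filter fun ω => visits m ω = 1) : ℝ) ≤ 387420489 := by
    calc (#((ipwb m).filter fun ω => visits m ω = 1) : ℝ) ≤ #(ipwb m) := by
          exact_mod_cast Finset.card_le_card (Finset.filter_subset _ _)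
      _ ≤ 3 ^ m := card_ipwb_le_three_pow m
      _ = 387420489 := by rw [hm]; norm_num
  have hden : y ^ 9 ≤ wallRate y ^ 18 := pow_le_wallRate_pow_sm hy0 9
  have hβ : 0 < wallRate y ^ 18 := pow_pos (wallRate_pos y) 18
  have h1 : (#((ipwb m).filter fun ω => visits m ω = 1) : ℝ) * y / wallRate y ^ 18 ≤ 387420489 * y / y ^ 9 :=
    calc (#((ipwb m).filter fun ω => visits m ω = 1) : ℝ) * y / wallRate y ^ 18 ≤ 387420489 * y / wallRate y ^ 18 :=
          div_le_div_of_nonneg_right (mul_le_mul_of_nonneg_right hN hy0.le) hβ.le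
      _ ≤ 387420489 * y / y ^ 9 := div_le_div_of_nonneg_left (by positivity) (by positivity) hden
  have e1 : (387420489 : ℝ) * y / y ^ 9 = 387420489 / y ^ 8 := by rw [div_eq_div_iff (by positivity) (by positivity)]; ring
  rw [e1] at h1
  have es : 8 * ((#((ipwb m).filter fun ω => visits m ω = 1) * y + 34 * y ^ 2 + y ^ 3) / wallRate y ^ 18) =
      8 * ((#((ipwb m).filter fun ω => visits m ω = 1) : ℝ) * y / wallRate y ^ 18) + (272 * y ^ 2 + 8 * y ^ 3) / wallRate y ^ 18 := by
    ring
  have e8 : (3099363912 : ℝ) / y ^ 8 = 8 * (387420489 / y ^ 8) := by ring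
  rw [es, e8]
  linarith

open Classical in
/-- ★ `(272y² + 8y³)/β¹⁸ ≤ 8f₉(y)` for `y ≥ 0` (the `N₉,₁` one-visit eighteens dropped). [cite: MadrasSlade1993, Section 4.2, (4.2.2) (p. 91)] [cite: Kesten1963SAW, Section 4] -/
theorem div_le_eight_mul_pwbLaw_nine (hy : 0 ≤ y) : (272 * y ^ 2 + 8 * y ^ 3) / wallRate y ^ 18 ≤ 8 * pwbLaw y 9 := by
  obtain ⟨m, hm⟩ : ∃ m : ℕ, m = 18 := ⟨_, rfl⟩
  have e : pwbLaw y 9 = IPWB m y / wallRate y ^ m := by rw [pwbLaw, hm]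
  have h18 : wallRate y ^ m = wallRate y ^ 18 := by rw [hm]
  rw [e, IPWB_eighteen_eq hm, h18]
  have hβ : 0 < wallRate y ^ 18 := pow_pos (wallRate_pos y) 18
  have hN : (0 : ℝ) ≤ (#((ipwb m).filter fun ω => visits m ω = 1) : ℝ) * y / wallRate y ^ 18 :=
    div_nonneg (mul_nonneg (Nat.cast_nonneg _) hy) hβ.le
  have es : 8 * ((#((ipwb m).filter fun ω => visits m ω = 1) * y + 34 * y ^ 2 + y ^ 3) / wallRate y ^ 18) =
      8 * ((#((ipwb m).filter fun ω => visits m ω = 1) : ℝ) * y / wallRate y ^ 18) + (272 * y ^ 2 + 8 * y ^ 3) / wallRate y ^ 18 := by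
    ring
  rw [es]
  linarith

open Classical in
/-- ★ **`9f₁₀` two-sided**: `63y³/β²⁰ ≤ 9f₁₀(y) ≤ 63y³/β²⁰ + 62762119218/y⁸` (`y ≥ 1` for the upper bound; `Λ₂₀ = N₁₀,₁y + N₁₀,₂y² + 7y³`,
`N₁₀,ᵥ ≤ 3²⁰`, `y + y² ≤ 2y²`, `β²⁰ ≥ y¹⁰`; «SEVEN-CENSUS»). [cite: MadrasSlade1993, Section 1.2, (1.2.3); Section 4.2, (4.2.2)–(4.2.5) (p. 91)] [cite: Kesten1963SAW, Section 4] -/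
theorem nine_mul_pwbLaw_ten_le_seven (hy : 1 ≤ y) : 9 * pwbLaw y 10 ≤ 63 * y ^ 3 / wallRate y ^ 20 + 62762119218 / y ^ 8 := by
  have hy0 : 0 < y := by linarith
  obtain ⟨m, hm⟩ : ∃ m : ℕ, m = 20 := ⟨_, rfl⟩
  have e : pwbLaw y 10 = IPWB m y / wallRate y ^ m := by rw [pwbLaw, hm]
  have h20 : wallRate y ^ m = wallRate y ^ 20 := by rw [hm]
  rw [e, IPWB_twenty_eq hm, h20]
  set N₁ := (#((ipwb m).filter fun ω => visits m ω = 1) : ℝ) with hN₁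
  set N₂ := (#((ipwb m).filter fun ω => visits m ω = 2) : ℝ) with hN₂
  have hc : (#(ipwb m) : ℝ) ≤ 3486784401 := by
    calc (#(ipwb m) : ℝ) ≤ 3 ^ m := card_ipwb_le_three_pow m
      _ = 3486784401 := by rw [hm]; norm_num
  have hN1 : N₁ ≤ 3486784401 :=
    le_trans (by rw [hN₁]; exact_mod_cast Finset.card_le_card (Finset.filter_subset _ _)) hc
  have hN2 : N₂ ≤ 3486784401 :=
    le_trans (by rw [hN₂]; exact_mod_cast Finset.card_le_card (Finset.filter_subset _ _)) hc
  have hN1' : 0 ≤ N₁ := by rw [hN₁]; exact Nat.cast_nonneg _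
  have hN2' : 0 ≤ N₂ := by rw [hN₂]; exact Nat.cast_nonneg _
  have hden : y ^ 10 ≤ wallRate y ^ 20 := pow_le_wallRate_pow_sm hy0 10
  have hβ : 0 < wallRate y ^ 20 := pow_pos (wallRate_pos y) 20
  have hyy : y ≤ y ^ 2 := by nlinarith
  have hnum : N₁ * y + N₂ * y ^ 2 ≤ 3486784401 * (2 * y ^ 2) := by nlinarith
  have h1 : (N₁ * y + N₂ * y ^ 2) / wallRate y ^ 20 ≤ 3486784401 * (2 * y ^ 2) / y ^ 10 :=
    calc (N₁ * y + N₂ * y ^ 2) / wallRate y ^ 20 ≤ 3486784401 * (2 * y ^ 2) / wallRate y ^ 20 :=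
          div_le_div_of_nonneg_right hnum hβ.le
      _ ≤ 3486784401 * (2 * y ^ 2) / y ^ 10 := div_le_div_of_nonneg_left (by positivity) (by positivity) hden
  have e1 : (3486784401 : ℝ) * (2 * y ^ 2) / y ^ 10 = 6973568802 / y ^ 8 := by
    rw [div_eq_div_iff (by positivity) (by positivity)]; ring
  rw [e1] at h1
  have es : 9 * ((N₁ * y + N₂ * y ^ 2 + 7 * y ^ 3) / wallRate y ^ 20) =
      9 * ((N₁ * y + N₂ * y ^ 2) / wallRate y ^ 20) + 63 * y ^ 3 / wallRate y ^ 20 := by ring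
  have e9 : (62762119218 : ℝ) / y ^ 8 = 9 * (6973568802 / y ^ 8) := by ring
  rw [es, e9]
  linarith

open Classical in
/-- ★ `63y³/β²⁰ ≤ 9f₁₀(y)` for `y ≥ 0` (the one- and two-visit twenties dropped). [cite: MadrasSlade1993, Section 4.2, (4.2.2) (p. 91)] [cite: Kesten1963SAW, Section 4] -/
theorem div_le_nine_mul_pwbLaw_ten (hy : 0 ≤ y) : 63 * y ^ 3 / wallRate y ^ 20 ≤ 9 * pwbLaw y 10 := by
  obtain ⟨m, hm⟩ : ∃ m : ℕ, m = 20 := ⟨_, rfl⟩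
  have e : pwbLaw y 10 = IPWB m y / wallRate y ^ m := by rw [pwbLaw, hm]
  have h20 : wallRate y ^ m = wallRate y ^ 20 := by rw [hm]
  rw [e, IPWB_twenty_eq hm, h20]
  have hβ : 0 < wallRate y ^ 20 := pow_pos (wallRate_pos y) 20
  have hN : (0 : ℝ) ≤ ((#((ipwb m).filter fun ω => visits m ω = 1) : ℝ) * y +
      (#((ipwb m).filter fun ω => visits m ω = 2) : ℝ) * y ^ 2) / wallRate y ^ 20 :=
    div_nonneg (add_nonneg (mul_nonneg (Nat.cast_nonneg _) hy) (mul_nonneg (Nat.cast_nonneg _) (pow_nonneg hy 2))) hβ.le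
  have es : 9 * (((#((ipwb m).filter fun ω => visits m ω = 1) : ℝ) * y + (#((ipwb m).filter fun ω => visits m ω = 2) : ℝ) * y ^ 2 +
      7 * y ^ 3) / wallRate y ^ 20) =
      9 * ((((#((ipwb m).filter fun ω => visits m ω = 1) : ℝ) * y + (#((ipwb m).filter fun ω => visits m ω = 2) : ℝ) * y ^ 2)) /
        wallRate y ^ 20) + 63 * y ^ 3 / wallRate y ^ 20 := by
    ring
  rw [es]
  linarith

/-- **Excess decomposition at order seven**: `Σ_{j ≥ 0} (j + 15) f_{j+16}(y) = m(y) − 1 − (2f₃ + 3f₄ + … + 14f₁₅)` (`y > μ⁴`).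
[cite: MadrasSlade1993, Section 4.2, (4.2.4)–(4.2.5) and Theorem 4.2.2 (pp. 91–92)] [cite: Feller1968, XIII.3] -/
theorem hasSum_excess_tail_sixteen (hy : hexConnectiveConstant ^ 4 < y) :
    HasSum (fun j : ℕ => ((j : ℝ) + 15) * pwbLaw y (j + 16))
      (pwbMean y - 1 - (2 * pwbLaw y 3 + 3 * pwbLaw y 4 + 4 * pwbLaw y 5 + 5 * pwbLaw y 6 + 6 * pwbLaw y 7 + 7 * pwbLaw y 8 +
        8 * pwbLaw y 9 + 9 * pwbLaw y 10 + 10 * pwbLaw y 11 + 11 * pwbLaw y 12 + 12 * pwbLaw y 13 + 13 * pwbLaw y 14 +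
        14 * pwbLaw y 15)) := by
  have ht := (hasSum_nat_add_iff' 2).2 (hasSum_excess_tail_fourteen hy)
  have hsum : ∑ i ∈ Finset.range 2, ((i : ℝ) + 13) * pwbLaw y (i + 14) = 13 * pwbLaw y 14 + 14 * pwbLaw y 15 := by
    simp only [Finset.sum_range_succ, Finset.sum_range_zero]
    push_cast
    ring
  rw [hsum] at ht
  have e : pwbMean y - 1 - (2 * pwbLaw y 3 + 3 * pwbLaw y 4 + 4 * pwbLaw y 5 + 5 * pwbLaw y 6 + 6 * pwbLaw y 7 + 7 * pwbLaw y 8 +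
        8 * pwbLaw y 9 + 9 * pwbLaw y 10 + 10 * pwbLaw y 11 + 11 * pwbLaw y 12 + 12 * pwbLaw y 13 + 13 * pwbLaw y 14 +
        14 * pwbLaw y 15) =
      pwbMean y - 1 - (2 * pwbLaw y 3 + 3 * pwbLaw y 4 + 4 * pwbLaw y 5 + 5 * pwbLaw y 6 + 6 * pwbLaw y 7 + 7 * pwbLaw y 8 +
        8 * pwbLaw y 9 + 9 * pwbLaw y 10 + 10 * pwbLaw y 11 + 11 * pwbLaw y 12 + 12 * pwbLaw y 13) -
        (13 * pwbLaw y 14 + 14 * pwbLaw y 15) := by ring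
  rw [e]
  refine ht.congr_fun fun j => ?_
  rw [show j + 2 + 14 = j + 16 by omega]
  push_cast
  ring

/-- ★ **Tail bound at order seven**: for `y ≥ 48`, `m(y) − 1 − (2f₃ + … + 14f₁₅) ≤ 32 μ³⁴/(y⁷√y)` (envelope `f_s ≤ μ²√y θ^s`, `θ = μ²/√y ≤ ½`,
`Σ_j (j + 15)θ^j ≤ 2 + 30`, prefactor `μ²√y θ¹⁶ = μ³⁴/(y⁷√y)`). [cite: MadrasSlade1993, Section 4.2, Theorem 4.2.2 and remark before (4.2.21) (pp. 91–94)] [cite: Feller1968, XIII.3] -/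
theorem excess_tail_sixteen_le (hy : 48 ≤ y) :
    pwbMean y - 1 - (2 * pwbLaw y 3 + 3 * pwbLaw y 4 + 4 * pwbLaw y 5 + 5 * pwbLaw y 6 + 6 * pwbLaw y 7 + 7 * pwbLaw y 8 +
        8 * pwbLaw y 9 + 9 * pwbLaw y 10 + 10 * pwbLaw y 11 + 11 * pwbLaw y 12 + 12 * pwbLaw y 13 + 13 * pwbLaw y 14 +
        14 * pwbLaw y 15) ≤
      32 * hexConnectiveConstant ^ 34 / (y ^ 7 * Real.sqrt y) := by
  have hy0 : 0 < y := by linarith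
  have hy1 : 1 ≤ y := by linarith
  have hμ : hexConnectiveConstant ^ 4 < y := mu_four_lt_twelve_sm.trans_le (by linarith)
  have hθhalf := theta_le_half_sm hy
  have hs0 : 0 < Real.sqrt y := Real.sqrt_pos.2 hy0
  have hμ2 : 0 < hexConnectiveConstant ^ 2 := pow_pos hexConnectiveConstant_pos 2
  have hθ0 : 0 < hexConnectiveConstant ^ 2 / Real.sqrt y := div_pos hμ2 hs0
  have hθ1 : hexConnectiveConstant ^ 2 / Real.sqrt y < 1 := by linarith
  have ht := hasSum_excess_tail_sixteen hμ
  have hG1 : HasSum (fun j : ℕ => (j : ℝ) * (hexConnectiveConstant ^ 2 / Real.sqrt y) ^ j)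
      ((hexConnectiveConstant ^ 2 / Real.sqrt y) / (1 - hexConnectiveConstant ^ 2 / Real.sqrt y) ^ 2) :=
    hasSum_coe_mul_geometric_of_norm_lt_one (by rw [Real.norm_of_nonneg hθ0.le]; exact hθ1)
  have hG0 : HasSum (fun j : ℕ => (hexConnectiveConstant ^ 2 / Real.sqrt y) ^ j)
      (1 - hexConnectiveConstant ^ 2 / Real.sqrt y)⁻¹ := hasSum_geometric_of_lt_one hθ0.le hθ1
  have hG : HasSum (fun j : ℕ => ((j : ℝ) + 15) *
      (hexConnectiveConstant ^ 2 * Real.sqrt y * (hexConnectiveConstant ^ 2 / Real.sqrt y) ^ (j + 16)))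
      (hexConnectiveConstant ^ 2 * Real.sqrt y * (hexConnectiveConstant ^ 2 / Real.sqrt y) ^ 16 *
        ((hexConnectiveConstant ^ 2 / Real.sqrt y) / (1 - hexConnectiveConstant ^ 2 / Real.sqrt y) ^ 2 +
          15 * (1 - hexConnectiveConstant ^ 2 / Real.sqrt y)⁻¹)) := by
    have h := (hG1.add (hG0.mul_left 15)).mul_left
      (hexConnectiveConstant ^ 2 * Real.sqrt y * (hexConnectiveConstant ^ 2 / Real.sqrt y) ^ 16)
    exact h.congr_fun fun j => by ring
  have hle := hasSum_le (fun j => mul_le_mul_of_nonneg_left (pwbLaw_le_geom hy1 (j + 16)) (by positivity)) ht hG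
  set θ := hexConnectiveConstant ^ 2 / Real.sqrt y with hθ_def
  have h1θ : 1 / 2 ≤ 1 - θ := by linarith
  have hinv : (1 - θ)⁻¹ ≤ 2 := by
    rw [inv_le_comm₀ (by linarith) (by norm_num)]
    linarith
  have hq : 1 / 4 ≤ (1 - θ) ^ 2 := by nlinarith
  have hdiv : θ / (1 - θ) ^ 2 ≤ 2 := by
    rw [div_le_iff₀ (by positivity)]
    linarith
  have hsum : θ / (1 - θ) ^ 2 + 15 * (1 - θ)⁻¹ ≤ 32 := by linarith
  set s := Real.sqrt y with hs_def
  have hys : y = s ^ 2 := (Real.sq_sqrt hy0.le).symm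
  have hE0 : 0 ≤ hexConnectiveConstant ^ 2 * s * θ ^ 16 := by positivity
  have hEθ : hexConnectiveConstant ^ 2 * s * θ ^ 16 = hexConnectiveConstant ^ 34 / (y ^ 7 * s) := by
    rw [show y ^ 7 * s = s ^ 15 by rw [hys]; ring, hθ_def, div_pow, ← mul_div_assoc,
      div_eq_div_iff (pow_ne_zero 16 hs0.ne') (pow_ne_zero 15 hs0.ne')]
    ring
  calc pwbMean y - 1 - (2 * pwbLaw y 3 + 3 * pwbLaw y 4 + 4 * pwbLaw y 5 + 5 * pwbLaw y 6 + 6 * pwbLaw y 7 + 7 * pwbLaw y 8 +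
        8 * pwbLaw y 9 + 9 * pwbLaw y 10 + 10 * pwbLaw y 11 + 11 * pwbLaw y 12 + 12 * pwbLaw y 13 + 13 * pwbLaw y 14 +
        14 * pwbLaw y 15)
      ≤ hexConnectiveConstant ^ 2 * s * θ ^ 16 * (θ / (1 - θ) ^ 2 + 15 * (1 - θ)⁻¹) := hle
    _ ≤ hexConnectiveConstant ^ 2 * s * θ ^ 16 * 32 := mul_le_mul_of_nonneg_left hsum hE0
    _ = 32 * hexConnectiveConstant ^ 34 / (y ^ 7 * s) := by rw [hEθ]; ring

/-- ★★ **Lower bound at order seven** (`y > μ⁴`): `272·(y⁹/β¹⁸) + 63·(y¹⁰/β²⁰) ≤ y⁷ E₇(y)`,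
`E₇ := m − 1 − 2y/β⁶ − 3y/β⁸ − 12y/β¹⁰ − (30y + 5y²)/β¹² − (90y + 18y²)/β¹⁴ − (266y + 77y²)/β¹⁶ − 8y³/β¹⁸` (every block of half-length
`≤ 8` is explicit — `7f₈ = (266y + 77y²)/β¹⁶` by «SEVEN-CENSUS» — and the 34 two-visit eighteens, the 7 three-visit twenties and all the rest are `≥ 0`).
[cite: MadrasSlade1993, Section 4.2, (4.2.4)–(4.2.5) and Theorem 4.2.2 (pp. 91–92)] [cite: Kesten1963SAW, Section 4] -/
theorem lower_seven_pwbMean (hy : hexConnectiveConstant ^ 4 < y) :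
    272 * (y ^ 9 / wallRate y ^ 18) + 63 * (y ^ 10 / wallRate y ^ 20) ≤
      y ^ 7 * (pwbMean y - 1 - 2 * y / wallRate y ^ 6 - 3 * y / wallRate y ^ 8 - 12 * y / wallRate y ^ 10 -
        (30 * y + 5 * y ^ 2) / wallRate y ^ 12 - (90 * y + 18 * y ^ 2) / wallRate y ^ 14 - (266 * y + 77 * y ^ 2) / wallRate y ^ 16 -
        8 * y ^ 3 / wallRate y ^ 18) := by
  have hy0 : 0 < y := lt_of_le_of_lt (by positivity) hy
  have hnn : 0 ≤ pwbMean y - 1 - (2 * pwbLaw y 3 + 3 * pwbLaw y 4 + 4 * pwbLaw y 5 + 5 * pwbLaw y 6 + 6 * pwbLaw y 7 + 7 * pwbLaw y 8 +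
      8 * pwbLaw y 9 + 9 * pwbLaw y 10 + 10 * pwbLaw y 11) :=
    (hasSum_excess_tail_twelve hy).nonneg fun j => mul_nonneg (by positivity) (pwbLaw_nonneg hy0.le _)
  have h9 := div_le_eight_mul_pwbLaw_nine hy0.le
  have h10 := div_le_nine_mul_pwbLaw_ten hy0.le
  have h11 : 0 ≤ pwbLaw y 11 := pwbLaw_nonneg hy0.le 11
  rw [pwbLaw_three y, pwbLaw_four_eq y, pwbLaw_five_eq y, pwbLaw_six_eq_six y, pwbLaw_seven_eq_exact y, pwbLaw_eight_eq_exact y] at hnn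
  have hle : 272 * y ^ 2 / wallRate y ^ 18 + 63 * y ^ 3 / wallRate y ^ 20 ≤
      pwbMean y - 1 - 2 * y / wallRate y ^ 6 - 3 * y / wallRate y ^ 8 - 12 * y / wallRate y ^ 10 -
        (30 * y + 5 * y ^ 2) / wallRate y ^ 12 - (90 * y + 18 * y ^ 2) / wallRate y ^ 14 - (266 * y + 77 * y ^ 2) / wallRate y ^ 16 -
        8 * y ^ 3 / wallRate y ^ 18 := by
    have e1 : 2 * y / wallRate y ^ 6 = 2 * (y / wallRate y ^ 6) := by ring
    have e2 : 3 * y / wallRate y ^ 8 = 3 * (y / wallRate y ^ 8) := by ring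
    have e3 : 12 * y / wallRate y ^ 10 = 4 * (3 * y / wallRate y ^ 10) := by ring
    have e4 : (30 * y + 5 * y ^ 2) / wallRate y ^ 12 = 5 * ((6 * y + y ^ 2) / wallRate y ^ 12) := by ring
    have e5 : (90 * y + 18 * y ^ 2) / wallRate y ^ 14 = 6 * ((15 * y + 3 * y ^ 2) / wallRate y ^ 14) := by ring
    have e6 : (266 * y + 77 * y ^ 2) / wallRate y ^ 16 = 7 * ((38 * y + 11 * y ^ 2) / wallRate y ^ 16) := by ring
    have e7 : (272 * y ^ 2 + 8 * y ^ 3) / wallRate y ^ 18 = 272 * y ^ 2 / wallRate y ^ 18 + 8 * y ^ 3 / wallRate y ^ 18 := by ring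
    rw [e7] at h9
    rw [e1, e2, e3, e4, e5, e6]
    linarith
  have hmul := mul_le_mul_of_nonneg_left hle (pow_pos hy0 7).le
  have e : y ^ 7 * (272 * y ^ 2 / wallRate y ^ 18 + 63 * y ^ 3 / wallRate y ^ 20) =
      272 * (y ^ 9 / wallRate y ^ 18) + 63 * (y ^ 10 / wallRate y ^ 20) := by ring
  rw [e] at hmul
  exact hmul

/-- ★★ **Upper bound at order seven** (`y ≥ 48`):
`y⁷ E₇(y) ≤ 272·(y⁹/β¹⁸) + 63·(y¹⁰/β²⁰) + 3213862938160038/y + 32 μ³⁴/√y` (the one-visit eighteens, the one- and two-visit twenties and the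
half-lengths `11 … 15` by the crude count, the tail beyond fifteen by the envelope).
[cite: MadrasSlade1993, Section 4.2, (4.2.2)–(4.2.5) and Theorem 4.2.2 (pp. 91–92)] [cite: Kesten1963SAW, Section 4] -/
theorem upper_seven_pwbMean (hy : 48 ≤ y) :
    y ^ 7 * (pwbMean y - 1 - 2 * y / wallRate y ^ 6 - 3 * y / wallRate y ^ 8 - 12 * y / wallRate y ^ 10 -
        (30 * y + 5 * y ^ 2) / wallRate y ^ 12 - (90 * y + 18 * y ^ 2) / wallRate y ^ 14 - (266 * y + 77 * y ^ 2) / wallRate y ^ 16 -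
        8 * y ^ 3 / wallRate y ^ 18) ≤
      272 * (y ^ 9 / wallRate y ^ 18) + 63 * (y ^ 10 / wallRate y ^ 20) + 3213862938160038 / y +
        32 * hexConnectiveConstant ^ 34 / Real.sqrt y := by
  have hy0 : 0 < y := by linarith
  have hy1 : 1 ≤ y := by linarith
  have hs0 : 0 < Real.sqrt y := Real.sqrt_pos.2 hy0
  have ht := excess_tail_sixteen_le hy
  have hh := head_ten_mul_pwbLaw_le hy1
  have h9 := eight_mul_pwbLaw_nine_le_seven hy1
  have h10 := nine_mul_pwbLaw_ten_le_seven hy1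
  rw [pwbLaw_three, pwbLaw_four_eq, pwbLaw_five_eq, pwbLaw_six_eq_six, pwbLaw_seven_eq_exact, pwbLaw_eight_eq_exact] at ht
  have hle : pwbMean y - 1 - 2 * y / wallRate y ^ 6 - 3 * y / wallRate y ^ 8 - 12 * y / wallRate y ^ 10 -
        (30 * y + 5 * y ^ 2) / wallRate y ^ 12 - (90 * y + 18 * y ^ 2) / wallRate y ^ 14 - (266 * y + 77 * y ^ 2) / wallRate y ^ 16 -
        8 * y ^ 3 / wallRate y ^ 18 ≤
      272 * y ^ 2 / wallRate y ^ 18 + 63 * y ^ 3 / wallRate y ^ 20 + 3213862938160038 / y ^ 8 +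
        32 * hexConnectiveConstant ^ 34 / (y ^ 7 * Real.sqrt y) := by
    have e1 : 2 * y / wallRate y ^ 6 = 2 * (y / wallRate y ^ 6) := by ring
    have e2 : 3 * y / wallRate y ^ 8 = 3 * (y / wallRate y ^ 8) := by ring
    have e3 : 12 * y / wallRate y ^ 10 = 4 * (3 * y / wallRate y ^ 10) := by ring
    have e4 : (30 * y + 5 * y ^ 2) / wallRate y ^ 12 = 5 * ((6 * y + y ^ 2) / wallRate y ^ 12) := by ring
    have e5 : (90 * y + 18 * y ^ 2) / wallRate y ^ 14 = 6 * ((15 * y + 3 * y ^ 2) / wallRate y ^ 14) := by ring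
    have e6 : (266 * y + 77 * y ^ 2) / wallRate y ^ 16 = 7 * ((38 * y + 11 * y ^ 2) / wallRate y ^ 16) := by ring
    have e7 : (272 * y ^ 2 + 8 * y ^ 3) / wallRate y ^ 18 = 272 * y ^ 2 / wallRate y ^ 18 + 8 * y ^ 3 / wallRate y ^ 18 := by ring
    have e8 : (3213862938160038 : ℝ) / y ^ 8 = 3099363912 / y ^ 8 + 62762119218 / y ^ 8 + 3213797076676908 / y ^ 8 := by
      rw [← add_div, ← add_div]; norm_num
    rw [e7] at h9
    rw [e1, e2, e3, e4, e5, e6, e8]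
    linarith
  have hm := mul_le_mul_of_nonneg_left hle (pow_pos hy0 7).le
  have f1 : y ^ 7 * (272 * y ^ 2 / wallRate y ^ 18) = 272 * (y ^ 9 / wallRate y ^ 18) := by ring
  have f2 : y ^ 7 * (63 * y ^ 3 / wallRate y ^ 20) = 63 * (y ^ 10 / wallRate y ^ 20) := by ring
  have f3 : y ^ 7 * (3213862938160038 / y ^ 8) = 3213862938160038 / y := by
    rw [mul_div_assoc', div_eq_div_iff (by positivity) (by positivity)]; ring
  have f4 : y ^ 7 * (32 * hexConnectiveConstant ^ 34 / (y ^ 7 * Real.sqrt y)) = 32 * hexConnectiveConstant ^ 34 / Real.sqrt y := by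
    rw [mul_div_assoc', div_eq_div_iff (by positivity) (by positivity)]; ring
  calc _ ≤ y ^ 7 * (272 * y ^ 2 / wallRate y ^ 18 + 63 * y ^ 3 / wallRate y ^ 20 + 3213862938160038 / y ^ 8 +
          32 * hexConnectiveConstant ^ 34 / (y ^ 7 * Real.sqrt y)) := hm
    _ = _ := by rw [mul_add, mul_add, mul_add, f1, f2, f3, f4]

/-! ### §3  THE SEVENTH-ORDER LIMIT `→ 335 = 8·N₉,₂ + 9·N₁₀,₃` -/

/-- `y¹⁰/β(y)²⁰ → 1`. [cite: BeatonBousquetMelouDeGierDuminilCopinGuttmann2014, Section 3.1, Proposition 5 (arXiv v5 p. 9)] -/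
theorem tendsto_pow_ten_div_wallRate_pow_twenty : Tendsto (fun y : ℝ => y ^ 10 / wallRate y ^ 20) atTop (𝓝 1) := by
  have h1 : Tendsto (fun y : ℝ => ((wallRate y / Real.sqrt y) ^ 20)⁻¹) atTop (𝓝 ((1 : ℝ) ^ 20)⁻¹) :=
    (tendsto_wallRate_div_sqrt.pow 20).inv₀ (by norm_num)
  rw [one_pow, inv_one] at h1
  refine h1.congr' ?_
  filter_upwards [eventually_gt_atTop (0 : ℝ)] with y hy
  have hs : Real.sqrt y ^ 20 = y ^ 10 := by rw [show (20 : ℕ) = 2 * 10 by norm_num, pow_mul, Real.sq_sqrt hy.le]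
  rw [div_pow, hs, inv_div]

/-- ★★★ **`y⁷ (m(y) − 1 − 2y/β⁶ − 3y/β⁸ − 12y/β¹⁰ − (30y + 5y²)/β¹² − (90y + 18y²)/β¹⁴ − (266y + 77y²)/β¹⁶ − 8y³/β¹⁸) → 335`** (`y → ∞`),
`335 = 8·N₉,₂ + 9·N₁₀,₃ = 8·34 + 9·7`: beyond the blocks of half-length `≤ 8` (ALL explicit since «SEVEN-CENSUS»: `7f₈ = (266y + 77y²)/β¹⁶`) and the
three-visit eighteen, the thirty-four two-visit eighteens and the seven three-visit twenties carry the whole seventh order of the renewal mean.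
[cite: MadrasSlade1993, Section 4.2, (4.2.5) and Theorem 4.2.2 (pp. 91–92)] [cite: Kesten1963SAW, Section 4] [cite: JansevanRensburg2000, Section 3.3.2, Lemma 3.20] -/
theorem tendsto_pow_seven_mul_pwbMean_sub :
    Tendsto (fun y : ℝ => y ^ 7 * (pwbMean y - 1 - 2 * y / wallRate y ^ 6 - 3 * y / wallRate y ^ 8 - 12 * y / wallRate y ^ 10 -
      (30 * y + 5 * y ^ 2) / wallRate y ^ 12 - (90 * y + 18 * y ^ 2) / wallRate y ^ 14 - (266 * y + 77 * y ^ 2) / wallRate y ^ 16 -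
      8 * y ^ 3 / wallRate y ^ 18)) atTop (𝓝 335) := by
  have h0 : Tendsto (fun y : ℝ => 272 * (y ^ 9 / wallRate y ^ 18) + 63 * (y ^ 10 / wallRate y ^ 20)) atTop (𝓝 335) := by
    have h := (tendsto_pow_nine_div_wallRate_pow_eighteen.const_mul 272).add (tendsto_pow_ten_div_wallRate_pow_twenty.const_mul 63)
    norm_num at h
    exact h
  have h1 : Tendsto (fun y : ℝ => (3213862938160038 : ℝ) / y) atTop (𝓝 0) := tendsto_const_nhds.div_atTop tendsto_id
  have h2 : Tendsto (fun y : ℝ => 32 * hexConnectiveConstant ^ 34 / Real.sqrt y) atTop (𝓝 0) :=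
    tendsto_const_nhds.div_atTop Real.tendsto_sqrt_atTop
  have hup : Tendsto (fun y : ℝ => 272 * (y ^ 9 / wallRate y ^ 18) + 63 * (y ^ 10 / wallRate y ^ 20) + 3213862938160038 / y +
      32 * hexConnectiveConstant ^ 34 / Real.sqrt y) atTop (𝓝 335) := by
    simpa using (h0.add h1).add h2
  refine tendsto_of_tendsto_of_tendsto_of_le_of_le' h0 hup ?_ ?_
  · filter_upwards [eventually_gt_atTop (hexConnectiveConstant ^ 4)] with y hy
    exact lower_seven_pwbMean hy
  · filter_upwards [eventually_ge_atTop (48 : ℝ)] with y hy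
    exact upper_seven_pwbMean hy

/-- ★ For every `ε > 0`, eventually `y⁷ E₇(y) ∈ (335 − ε, 335 + ε)`. [cite: MadrasSlade1993, Section 4.2, (4.2.5) (p. 91)] -/
theorem eventually_pow_seven_mul_pwbMean_mem {ε : ℝ} (hε : 0 < ε) :
    ∀ᶠ y : ℝ in atTop, y ^ 7 * (pwbMean y - 1 - 2 * y / wallRate y ^ 6 - 3 * y / wallRate y ^ 8 - 12 * y / wallRate y ^ 10 -
      (30 * y + 5 * y ^ 2) / wallRate y ^ 12 - (90 * y + 18 * y ^ 2) / wallRate y ^ 14 - (266 * y + 77 * y ^ 2) / wallRate y ^ 16 -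
      8 * y ^ 3 / wallRate y ^ 18) ∈ Set.Ioo (335 - ε) (335 + ε) :=
  tendsto_pow_seven_mul_pwbMean_sub.eventually (Ioo_mem_nhds (by linarith) (by linarith))


/-! ### §4  THE PURE-POWER FORM: `m(y) = 1 + 2/y² + 3/y³ + 11/y⁴ + 30/y⁵ + 73/y⁶ + 211/y⁷ + o(y⁻⁷)` — it needs `β²` only through `4/y⁴`
two-sided (the fifth rung `H` of §1): each explicit renewal term `(s − 1)Λ_{2s}(y)/β^{2s}` is an EXACT polynomial in the tower
`A = y²(1 − r)`, `Q = y³(1 − r) − y`, `P = y⁴(1 − r) − y² − y`, `H = y⁵(1 − r) − y³ − y² − y` (`r = y/β²`) and `u = 1/y`, plus its pure-power head;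
the identities are checked by `ring`, the limits are `A, Q, P → 1`, `H → 2`, `u → 0` -/

/-- **The dip term to seventh order**: `y⁷·(2y/β⁶) − 2y⁵ + 6y³ + 6y² → 0` (`2y/β⁶ = 2/y² − 6/y⁴ − 6/y⁵ + 0/y⁶ + 0/y⁷ + o(y⁻⁷)`; exact polynomial identity in `A = y²(1 − r)`, `Q = y³(1 − r) − y`, `H = y⁵(1 − r) − y³ − y² − y`, `u = 1/y`, then `A, Q → 1`, `H → 2`).
[cite: BeatonBousquetMelouDeGierDuminilCopinGuttmann2014, Section 3.1, Proposition 5 (arXiv v5 p. 9)] [cite: MadrasSlade1993, Section 4.2, (4.2.2) (p. 91)] -/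
theorem tendsto_pow_seven_mul_two_mul_div_sub :
    Tendsto (fun y : ℝ => y ^ 7 * (2 * y / wallRate y ^ 6) - 2 * y ^ 5 + 6 * y ^ 3 + 6 * y ^ 2) atTop (𝓝 0) := by
  have hA := tendsto_sq_mul_one_sub_div_wallRate_sq
  have hQ := tendsto_cube_mul_one_sub_div_sub
  have hH := tendsto_pow_five_mul_one_sub_div_sub
  have hu : Tendsto (fun y : ℝ => y⁻¹) atTop (𝓝 0) := tendsto_inv_atTop_zero
  have h := (((((hA.mul hQ).const_mul (6 : ℝ)).add
      (hQ.const_mul (6 : ℝ))).add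
      (hH.const_mul ((-6) : ℝ))).add
      (((hA.pow 3).mul hu).const_mul ((-2) : ℝ)))
  refine Tendsto.congr' ?_ (tendsto_of_tendsto_of_eq_sm h (by norm_num))
  filter_upwards [eventually_gt_atTop (0 : ℝ)] with y hy
  have hw : wallRate y ≠ 0 := (wallRate_pos y).ne'
  have hy' : y ≠ 0 := hy.ne'
  field_simp
  ring

/-- **The flat-excursion term to seventh order**: `y⁷·(3y/β⁸) − 3y⁴ + 12y² + 12y → 6` (`P = y⁴(1 − r) − y² − y → 1`).
[cite: BeatonBousquetMelouDeGierDuminilCopinGuttmann2014, Section 3.1, Proposition 5 (arXiv v5 p. 9)] [cite: MadrasSlade1993, Section 4.2, (4.2.2) (p. 91)] -/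
theorem tendsto_pow_seven_mul_three_mul_div_sub :
    Tendsto (fun y : ℝ => y ^ 7 * (3 * y / wallRate y ^ 8) - 3 * y ^ 4 + 12 * y ^ 2 + 12 * y) atTop (𝓝 6) := by
  have hA := tendsto_sq_mul_one_sub_div_wallRate_sq
  have hP := tendsto_pow_four_mul_one_sub_div_sub
  have hu : Tendsto (fun y : ℝ => y⁻¹) atTop (𝓝 0) := tendsto_inv_atTop_zero
  have h := (((((hA.pow 2).const_mul (18 : ℝ)).add
      (hP.const_mul ((-12) : ℝ))).add
      (((hA.pow 3).mul (hu.pow 2)).const_mul ((-12) : ℝ))).add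
      (((hA.pow 4).mul (hu.pow 4)).const_mul (3 : ℝ)))
  refine Tendsto.congr' ?_ (tendsto_of_tendsto_of_eq_sm h (by norm_num))
  filter_upwards [eventually_gt_atTop (0 : ℝ)] with y hy
  have hw : wallRate y ≠ 0 := (wallRate_pos y).ne'
  have hy' : y ≠ 0 := hy.ne'
  field_simp
  ring

/-- **The tens to seventh order**: `y⁷·(12y/β¹⁰) − 12y³ + 60y → −60`.
[cite: BeatonBousquetMelouDeGierDuminilCopinGuttmann2014, Section 3.1, Proposition 5 (arXiv v5 p. 9)] [cite: MadrasSlade1993, Section 4.2, (4.2.2) (p. 91)] -/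
theorem tendsto_pow_seven_mul_twelve_mul_div_sub :
    Tendsto (fun y : ℝ => y ^ 7 * (12 * y / wallRate y ^ 10) - 12 * y ^ 3 + 60 * y) atTop (𝓝 (-60)) := by
  have hA := tendsto_sq_mul_one_sub_div_wallRate_sq
  have hQ := tendsto_cube_mul_one_sub_div_sub
  have hu : Tendsto (fun y : ℝ => y⁻¹) atTop (𝓝 0) := tendsto_inv_atTop_zero
  have h := (((((hQ.const_mul ((-60) : ℝ)).add
      (((hA.pow 2).mul hu).const_mul (120 : ℝ))).add
      (((hA.pow 3).mul (hu.pow 3)).const_mul ((-120) : ℝ))).add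
      (((hA.pow 4).mul (hu.pow 5)).const_mul (60 : ℝ))).add
      (((hA.pow 5).mul (hu.pow 7)).const_mul ((-12) : ℝ)))
  refine Tendsto.congr' ?_ (tendsto_of_tendsto_of_eq_sm h (by norm_num))
  filter_upwards [eventually_gt_atTop (0 : ℝ)] with y hy
  have hw : wallRate y ≠ 0 := (wallRate_pos y).ne'
  have hy' : y ≠ 0 := hy.ne'
  field_simp
  ring

/-- **The twelves to seventh order**: `y⁷·((30y + 5y²)/β¹²) − 5y³ − 30y² + 30y → −210`.
[cite: BeatonBousquetMelouDeGierDuminilCopinGuttmann2014, Section 3.1, Proposition 5 (arXiv v5 p. 9)] [cite: MadrasSlade1993, Section 4.2, (4.2.2) (p. 91)] -/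
theorem tendsto_pow_seven_mul_twelves_sub :
    Tendsto (fun y : ℝ => y ^ 7 * ((30 * y + 5 * y ^ 2) / wallRate y ^ 12) - 5 * y ^ 3 - 30 * y ^ 2 + 30 * y) atTop (𝓝 (-210)) := by
  have hA := tendsto_sq_mul_one_sub_div_wallRate_sq
  have hQ := tendsto_cube_mul_one_sub_div_sub
  have hu : Tendsto (fun y : ℝ => y⁻¹) atTop (𝓝 0) := tendsto_inv_atTop_zero
  have h := ((((((((((((hA.const_mul ((-180) : ℝ)).add
      (hQ.const_mul ((-30) : ℝ))).add
      (((hA.pow 2).mul hu).const_mul (75 : ℝ))).add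
      (((hA.pow 2).mul (hu.pow 2)).const_mul (450 : ℝ))).add
      (((hA.pow 3).mul (hu.pow 3)).const_mul ((-100) : ℝ))).add
      (((hA.pow 3).mul (hu.pow 4)).const_mul ((-600) : ℝ))).add
      (((hA.pow 4).mul (hu.pow 5)).const_mul (75 : ℝ))).add
      (((hA.pow 4).mul (hu.pow 6)).const_mul (450 : ℝ))).add
      (((hA.pow 5).mul (hu.pow 7)).const_mul ((-30) : ℝ))).add
      (((hA.pow 5).mul (hu.pow 8)).const_mul ((-180) : ℝ))).add
      (((hA.pow 6).mul (hu.pow 9)).const_mul (5 : ℝ))).add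
      (((hA.pow 6).mul (hu.pow 10)).const_mul (30 : ℝ)))
  refine Tendsto.congr' ?_ (tendsto_of_tendsto_of_eq_sm h (by norm_num))
  filter_upwards [eventually_gt_atTop (0 : ℝ)] with y hy
  have hw : wallRate y ≠ 0 := (wallRate_pos y).ne'
  have hy' : y ≠ 0 := hy.ne'
  field_simp
  ring

/-- **The fourteens to seventh order**: `y⁷·((90y + 18y²)/β¹⁴) − 18y² − 90y → −126`.
[cite: BeatonBousquetMelouDeGierDuminilCopinGuttmann2014, Section 3.1, Proposition 5 (arXiv v5 p. 9)] [cite: MadrasSlade1993, Section 4.2, (4.2.2) (p. 91)] -/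
theorem tendsto_pow_seven_mul_fourteens_sub :
    Tendsto (fun y : ℝ => y ^ 7 * ((90 * y + 18 * y ^ 2) / wallRate y ^ 14) - 18 * y ^ 2 - 90 * y) atTop (𝓝 (-126)) := by
  have hA := tendsto_sq_mul_one_sub_div_wallRate_sq
  have hu : Tendsto (fun y : ℝ => y⁻¹) atTop (𝓝 0) := tendsto_inv_atTop_zero
  have h := ((((((((((((((hA.const_mul ((-126) : ℝ)).add
      ((hA.mul hu).const_mul ((-630) : ℝ))).add
      (((hA.pow 2).mul (hu.pow 2)).const_mul (378 : ℝ))).add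
      (((hA.pow 2).mul (hu.pow 3)).const_mul (1890 : ℝ))).add
      (((hA.pow 3).mul (hu.pow 4)).const_mul ((-630) : ℝ))).add
      (((hA.pow 3).mul (hu.pow 5)).const_mul ((-3150) : ℝ))).add
      (((hA.pow 4).mul (hu.pow 6)).const_mul (630 : ℝ))).add
      (((hA.pow 4).mul (hu.pow 7)).const_mul (3150 : ℝ))).add
      (((hA.pow 5).mul (hu.pow 8)).const_mul ((-378) : ℝ))).add
      (((hA.pow 5).mul (hu.pow 9)).const_mul ((-1890) : ℝ))).add
      (((hA.pow 6).mul (hu.pow 10)).const_mul (126 : ℝ))).add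
      (((hA.pow 6).mul (hu.pow 11)).const_mul (630 : ℝ))).add
      (((hA.pow 7).mul (hu.pow 12)).const_mul ((-18) : ℝ))).add
      (((hA.pow 7).mul (hu.pow 13)).const_mul ((-90) : ℝ)))
  refine Tendsto.congr' ?_ (tendsto_of_tendsto_of_eq_sm h (by norm_num))
  filter_upwards [eventually_gt_atTop (0 : ℝ)] with y hy
  have hw : wallRate y ≠ 0 := (wallRate_pos y).ne'
  have hy' : y ≠ 0 := hy.ne'
  field_simp
  ring

/-- **The sixteens to seventh order**: `y⁷·((266y + 77y²)/β¹⁶) − 77y → 266` (`266 = 7·N₈,₁ = 7·38`).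
[cite: BeatonBousquetMelouDeGierDuminilCopinGuttmann2014, Section 3.1, Proposition 5 (arXiv v5 p. 9)] [cite: MadrasSlade1993, Section 4.2, (4.2.2) (p. 91)] -/
theorem tendsto_pow_seven_mul_sixteens_sub :
    Tendsto (fun y : ℝ => y ^ 7 * ((266 * y + 77 * y ^ 2) / wallRate y ^ 16) - 77 * y) atTop (𝓝 266) := by
  have hA := tendsto_sq_mul_one_sub_div_wallRate_sq
  have hu : Tendsto (fun y : ℝ => y⁻¹) atTop (𝓝 0) := tendsto_inv_atTop_zero
  have h := (((((((((((((((((tendsto_const_nhds (x := (266 : ℝ))).add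
      ((hA.mul hu).const_mul ((-616) : ℝ))).add
      ((hA.mul (hu.pow 2)).const_mul ((-2128) : ℝ))).add
      (((hA.pow 2).mul (hu.pow 3)).const_mul (2156 : ℝ))).add
      (((hA.pow 2).mul (hu.pow 4)).const_mul (7448 : ℝ))).add
      (((hA.pow 3).mul (hu.pow 5)).const_mul ((-4312) : ℝ))).add
      (((hA.pow 3).mul (hu.pow 6)).const_mul ((-14896) : ℝ))).add
      (((hA.pow 4).mul (hu.pow 7)).const_mul (5390 : ℝ))).add
      (((hA.pow 4).mul (hu.pow 8)).const_mul (18620 : ℝ))).add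
      (((hA.pow 5).mul (hu.pow 9)).const_mul ((-4312) : ℝ))).add
      (((hA.pow 5).mul (hu.pow 10)).const_mul ((-14896) : ℝ))).add
      (((hA.pow 6).mul (hu.pow 11)).const_mul (2156 : ℝ))).add
      (((hA.pow 6).mul (hu.pow 12)).const_mul (7448 : ℝ))).add
      (((hA.pow 7).mul (hu.pow 13)).const_mul ((-616) : ℝ))).add
      (((hA.pow 7).mul (hu.pow 14)).const_mul ((-2128) : ℝ))).add
      (((hA.pow 8).mul (hu.pow 15)).const_mul (77 : ℝ))).add
      (((hA.pow 8).mul (hu.pow 16)).const_mul (266 : ℝ)))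
  refine Tendsto.congr' ?_ (tendsto_of_tendsto_of_eq_sm h (by norm_num))
  filter_upwards [eventually_gt_atTop (0 : ℝ)] with y hy
  have hw : wallRate y ≠ 0 := (wallRate_pos y).ne'
  have hy' : y ≠ 0 := hy.ne'
  field_simp
  ring

/-- **The three-visit eighteen to seventh order**: `y⁷·(8y³/β¹⁸) − 8y → 0`.
[cite: BeatonBousquetMelouDeGierDuminilCopinGuttmann2014, Section 3.1, Proposition 5 (arXiv v5 p. 9)] [cite: MadrasSlade1993, Section 4.2, (4.2.2) (p. 91)] -/
theorem tendsto_pow_seven_mul_eight_cube_div_sub :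
    Tendsto (fun y : ℝ => y ^ 7 * (8 * y ^ 3 / wallRate y ^ 18) - 8 * y) atTop (𝓝 0) := by
  have hA := tendsto_sq_mul_one_sub_div_wallRate_sq
  have hu : Tendsto (fun y : ℝ => y⁻¹) atTop (𝓝 0) := tendsto_inv_atTop_zero
  have h := ((((((((((hA.mul hu).const_mul ((-72) : ℝ)).add
      (((hA.pow 2).mul (hu.pow 3)).const_mul (288 : ℝ))).add
      (((hA.pow 3).mul (hu.pow 5)).const_mul ((-672) : ℝ))).add
      (((hA.pow 4).mul (hu.pow 7)).const_mul (1008 : ℝ))).add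
      (((hA.pow 5).mul (hu.pow 9)).const_mul ((-1008) : ℝ))).add
      (((hA.pow 6).mul (hu.pow 11)).const_mul (672 : ℝ))).add
      (((hA.pow 7).mul (hu.pow 13)).const_mul ((-288) : ℝ))).add
      (((hA.pow 8).mul (hu.pow 15)).const_mul (72 : ℝ))).add
      (((hA.pow 9).mul (hu.pow 17)).const_mul ((-8) : ℝ)))
  refine Tendsto.congr' ?_ (tendsto_of_tendsto_of_eq_sm h (by norm_num))
  filter_upwards [eventually_gt_atTop (0 : ℝ)] with y hy
  have hw : wallRate y ≠ 0 := (wallRate_pos y).ne'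
  have hy' : y ≠ 0 := hy.ne'
  field_simp
  ring

/-- ★★★ **`y⁷ (m(y) − 1 − 2/y² − 3/y³ − 11/y⁴ − 30/y⁵ − 73/y⁶) → 211`**, i.e. **`m(y) = 1 + 2/y² + 3/y³ + 11/y⁴ + 30/y⁵ + 73/y⁶ + 211/y⁷ + o(y⁻⁷)`**
(`y → ∞`): `211 = 335 + 0 + 6 − 60 − 210 − 126 + 266 + 0` (the eighteens and twenties of §3; then the dip's, the flat excursion's, the tens', the
twelves', the fourteens', the sixteens' and the three-visit eighteen's own seventh-order corrections).  Only the fifth-order two-sided window of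
`β²` enters (through `H`). [cite: MadrasSlade1993, Section 4.2, (4.2.5) and Theorem 4.2.2 (pp. 91–92)] [cite: Kesten1963SAW, Section 4] [cite: EntingJensen2009, Section 7.4.2, Fig. 7.10] -/
theorem tendsto_pow_seven_mul_pwbMean_sub_six_terms :
    Tendsto (fun y : ℝ => y ^ 7 * (pwbMean y - 1 - 2 / y ^ 2 - 3 / y ^ 3 - 11 / y ^ 4 - 30 / y ^ 5 - 73 / y ^ 6)) atTop (𝓝 211) := by
  have h := ((((((tendsto_pow_seven_mul_pwbMean_sub.add tendsto_pow_seven_mul_two_mul_div_sub).add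
    tendsto_pow_seven_mul_three_mul_div_sub).add tendsto_pow_seven_mul_twelve_mul_div_sub).add tendsto_pow_seven_mul_twelves_sub).add
    tendsto_pow_seven_mul_fourteens_sub).add tendsto_pow_seven_mul_sixteens_sub).add tendsto_pow_seven_mul_eight_cube_div_sub
  refine Tendsto.congr' ?_ (tendsto_of_tendsto_of_eq_sm h (by norm_num))
  filter_upwards [eventually_gt_atTop (0 : ℝ)] with y hy
  have hy' : y ≠ 0 := hy.ne'
  have hw : wallRate y ≠ 0 := (wallRate_pos y).ne'
  field_simp
  ring

/-- ★ **Asymptotic equivalence** `m(y) − 1 − 2/y² − 3/y³ − 11/y⁴ − 30/y⁵ − 73/y⁶ ∼ 211/y⁷` (`y → ∞`).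
[cite: MadrasSlade1993, Section 4.2, Theorem 4.2.2 (pp. 91–92)] [cite: Kesten1963SAW, Section 4] -/
theorem isEquivalent_pwbMean_sub_six_terms :
    (fun y : ℝ => pwbMean y - 1 - 2 / y ^ 2 - 3 / y ^ 3 - 11 / y ^ 4 - 30 / y ^ 5 - 73 / y ^ 6) ~[atTop] fun y : ℝ => 211 / y ^ 7 := by
  have hz : ∀ᶠ y : ℝ in atTop, (211 : ℝ) / y ^ 7 ≠ 0 := by
    filter_upwards [eventually_gt_atTop (0 : ℝ)] with y hy
    positivity
  refine (isEquivalent_iff_tendsto_one hz).2 ?_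
  have h := tendsto_pow_seven_mul_pwbMean_sub_six_terms.div_const 211
  rw [show ((211 : ℝ) / 211) = 1 by norm_num] at h
  refine h.congr' ?_
  filter_upwards [eventually_gt_atTop (0 : ℝ)] with y hy
  simp only [Pi.div_apply]
  rw [div_div_eq_mul_div]
  ring


/-! ## Part II — the visit mean and the contact density to SEVENTH order

### §5  The visit excess at length twenty, its envelope from length twenty-two on, the series beyond half-length ten -/

open Classical in
/-- ★ **`Λ^v₂₀(y) − Λ₂₀(y) = N₁₀,₂·y² + 14y³`** (symbolic length; `N₁₀,₂ = #` two-visit blocks of length twenty, symbolic — data `99`):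
the seven three-visit twenties of «SEVEN-CENSUS» contribute `2·7·y³`. [cite: MadrasSlade1993, Section 4.2, (4.2.2) (p. 91)] [cite: Kesten1963SAW, Section 4] -/
theorem IPWBV_sub_IPWB_twenty {m : ℕ} (hm : m = 20) (y : ℝ) :
    IPWBV m y - IPWB m y = #((ipwb m).filter fun ω => visits m ω = 2) * y ^ 2 + 14 * y ^ 3 := by
  rw [IPWBV_sub_IPWB_eq_sum, ← Finset.sum_filter_add_sum_filter_not (ipwb m) (fun ω => visits m ω = 1),
    ← Finset.sum_filter_add_sum_filter_not ((ipwb m).filter fun ω => ¬ visits m ω = 1) (fun ω => visits m ω = 2)]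
  have h2 : (((ipwb m).filter fun ω => ¬ visits m ω = 1).filter fun ω => visits m ω = 2) =
      (ipwb m).filter fun ω => visits m ω = 2 := by
    rw [Finset.filter_filter]
    refine Finset.filter_congr fun ω _ => ?_
    omega
  have h3 : (((ipwb m).filter fun ω => ¬ visits m ω = 1).filter fun ω => ¬ visits m ω = 2) =
      (ipwb m).filter fun ω => visits m ω = 3 := by
    rw [Finset.filter_filter]
    refine Finset.filter_congr fun ω hω => ?_
    have h1 := one_le_visits_of_mem_ipwb hω
    have h4 := visits_le_three_of_mem_ipwb_twenty hm hω
    omega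
  have hv3 : ∀ i : Fin 7, visits m (TwentyThree.W i) = 3 := by rw [hm]; exact TwentyThree.visits_W
  rw [h2, h3, threeVisit_ipwb_twenty_eq_image hm, Finset.sum_image fun i _ j _ h => TwentyThree.W_injective h,
    Finset.sum_congr rfl fun (i : Fin 7) _ => by rw [hv3 i],
    Finset.sum_eq_zero fun ω hω => by rw [(Finset.mem_filter.1 hω).2]; push_cast; ring, zero_add,
    Finset.sum_congr rfl fun ω hω => by rw [(Finset.mem_filter.1 hω).2], Finset.sum_const, Finset.sum_const, Finset.card_univ,
    Fintype.card_fin, nsmul_eq_mul, nsmul_eq_mul]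
  push_cast
  ring

/-- **Envelope of the visit excess from length twenty-two on**: `Λ^v_n(y) − Λ_n(y) ≤ (n/2 − 9)·#(ipwb n)·y^{n/2 − 8}` for `n ≥ 22`, `y ≥ 1`
(each block has `1 ≤ visits ≤ n/2 − 8`, six-step law). [cite: MadrasSlade1993, Section 4.2, (4.2.2) and remark before (4.2.21) (pp. 91–94)] -/
theorem IPWBV_sub_IPWB_le_of_twentytwo_le (hn : 22 ≤ n) (hy : 1 ≤ y) :
    IPWBV n y - IPWB n y ≤ ((n / 2 - 9 : ℕ) : ℝ) * #(ipwb n) * y ^ (n / 2 - 8) := by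
  rw [IPWBV_sub_IPWB_eq_sum]
  have h := Finset.sum_le_card_nsmul (ipwb n) (fun ω => ((visits n ω : ℝ) - 1) * y ^ visits n ω)
    (((n / 2 - 9 : ℕ) : ℝ) * y ^ (n / 2 - 8)) fun ω hω => by
    have h1 := one_le_visits_of_mem_ipwb hω
    have h2 := visits_le_half_sub_eight hn hω
    have hv : ((visits n ω : ℝ) - 1) ≤ ((n / 2 - 9 : ℕ) : ℝ) := by
      have : visits n ω - 1 ≤ n / 2 - 9 := by omega
      have e : ((visits n ω : ℝ) - 1) = ((visits n ω - 1 : ℕ) : ℝ) := by push_cast [h1]; ring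
      rw [e]; exact_mod_cast this
    exact mul_le_mul hv (pow_le_pow_right₀ hy h2) (by positivity) (by positivity)
  rw [nsmul_eq_mul] at h
  calc _ ≤ (#(ipwb n) : ℝ) * (((n / 2 - 9 : ℕ) : ℝ) * y ^ (n / 2 - 8)) := h
    _ = _ := by ring

/-- ★ `(Λ^v − Λ)_{2s}(y)/β(y)^{2s} ≤ (s − 9)·9^s/y⁸` for `11 ≤ s`, `y ≥ 1` (`#(ipwb 2s) ≤ 3^{2s}`, `β^{2s} ≥ y^s`).
[cite: MadrasSlade1993, Section 1.2, (1.2.3); Section 4.2, (4.2.2) (p. 91)] -/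
theorem visitExcess_term_le_nine_pow_eight {s : ℕ} (hs : 11 ≤ s) (hy : 1 ≤ y) :
    (IPWBV (2 * s) y - IPWB (2 * s) y) / wallRate y ^ (2 * s) ≤ ((s : ℝ) - 9) * 9 ^ s / y ^ 8 := by
  have hy0 : 0 < y := by linarith
  have h1 := IPWBV_sub_IPWB_le_of_twentytwo_le (n := 2 * s) (by omega) hy
  rw [show 2 * s / 2 - 9 = s - 9 by omega, show 2 * s / 2 - 8 = s - 8 by omega] at h1
  have hc : (#(ipwb (2 * s)) : ℝ) ≤ 9 ^ s := by
    calc (#(ipwb (2 * s)) : ℝ) ≤ 3 ^ (2 * s) := card_ipwb_le_three_pow _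
      _ = 9 ^ s := by rw [pow_mul]; norm_num
  have hs9 : ((s - 9 : ℕ) : ℝ) = (s : ℝ) - 9 := by push_cast [show 9 ≤ s by omega]; ring
  have hs0 : (0 : ℝ) ≤ (s : ℝ) - 9 := by
    have : (9 : ℝ) ≤ s := by exact_mod_cast (show 9 ≤ s by omega)
    linarith
  have h2 : IPWBV (2 * s) y - IPWB (2 * s) y ≤ ((s : ℝ) - 9) * 9 ^ s * y ^ (s - 8) := by
    rw [hs9] at h1
    calc _ ≤ ((s : ℝ) - 9) * #(ipwb (2 * s)) * y ^ (s - 8) := h1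
      _ ≤ ((s : ℝ) - 9) * 9 ^ s * y ^ (s - 8) := by gcongr
  have hden : y ^ s ≤ wallRate y ^ (2 * s) := pow_le_wallRate_pow_sm hy0 s
  have hnum0 : 0 ≤ ((s : ℝ) - 9) * 9 ^ s * y ^ (s - 8) := by positivity
  calc (IPWBV (2 * s) y - IPWB (2 * s) y) / wallRate y ^ (2 * s) ≤ ((s : ℝ) - 9) * 9 ^ s * y ^ (s - 8) / wallRate y ^ (2 * s) :=
        div_le_div_of_nonneg_right h2 (pow_nonneg (wallRate_pos y).le _)
    _ ≤ ((s : ℝ) - 9) * 9 ^ s * y ^ (s - 8) / y ^ s := div_le_div_of_nonneg_left hnum0 (by positivity) hden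
    _ = ((s : ℝ) - 9) * 9 ^ s / y ^ 8 := by
        rw [div_eq_div_iff (by positivity) (by positivity)]
        rw [show ((s : ℝ) - 9) * 9 ^ s * y ^ (s - 8) * y ^ 8 = ((s : ℝ) - 9) * 9 ^ s * (y ^ (s - 8) * y ^ 8) by ring, ← pow_add,
          show s - 8 + 8 = s by omega]

open Classical in
/-- **The visit-excess series beyond half-length ten** (`y > μ⁴`; symbolic length twenty): `Σ_{j ≥ 0} (Λ^v − Λ)_{2(j+11)}/β^{2(j+11)} =
V − 1 − y²/β¹² − 3y²/β¹⁴ − 11y²/β¹⁶ − (34y² + 2y³)/β¹⁸ − (N₁₀,₂ y² + 14y³)/β²⁰` («SEVEN-CENSUS»: `N₉,₂ = 34`).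
[cite: MadrasSlade1993, Section 4.2, (4.2.4)–(4.2.5) and Theorem 4.2.2 (pp. 91–92)] [cite: Kesten1963SAW, Section 4] -/
theorem hasSum_visitExcess_twentytwo (hy : hexConnectiveConstant ^ 4 < y) {m : ℕ} (hm : m = 20) :
    HasSum (fun j : ℕ => (IPWBV (2 * (j + 11)) y - IPWB (2 * (j + 11)) y) / wallRate y ^ (2 * (j + 11)))
      (pwbVisitMean y - 1 - y ^ 2 / wallRate y ^ 12 - 3 * y ^ 2 / wallRate y ^ 14 - 11 * y ^ 2 / wallRate y ^ 16 -
        (34 * y ^ 2 + 2 * y ^ 3) / wallRate y ^ 18 - (#((ipwb m).filter fun ω => visits m ω = 2) * y ^ 2 + 14 * y ^ 3) / wallRate y ^ 20) := by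
  obtain ⟨m', hm'⟩ : ∃ m' : ℕ, m' = 18 := ⟨_, rfl⟩
  have h := (hasSum_nat_add_iff' 1).2 (hasSum_visitExcess_twenty hy hm')
  rw [card_twoVisit_ipwb_eighteen_eq_thirtyFour hm'] at h
  have e10 : (IPWBV (2 * (0 + 10)) y - IPWB (2 * (0 + 10)) y) / wallRate y ^ (2 * (0 + 10)) =
      (#((ipwb m).filter fun ω => visits m ω = 2) * y ^ 2 + 14 * y ^ 3) / wallRate y ^ 20 := by
    rw [show 2 * (0 + 10) = m by omega, IPWBV_sub_IPWB_twenty hm, hm]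
  have hsum : ∑ i ∈ Finset.range 1, (IPWBV (2 * (i + 10)) y - IPWB (2 * (i + 10)) y) / wallRate y ^ (2 * (i + 10)) =
      (#((ipwb m).filter fun ω => visits m ω = 2) * y ^ 2 + 14 * y ^ 3) / wallRate y ^ 20 := by
    rw [Finset.sum_range_succ, Finset.sum_range_zero, zero_add, e10]
  rw [hsum] at h
  have e : pwbVisitMean y - 1 - y ^ 2 / wallRate y ^ 12 - 3 * y ^ 2 / wallRate y ^ 14 - 11 * y ^ 2 / wallRate y ^ 16 -
        (34 * y ^ 2 + 2 * y ^ 3) / wallRate y ^ 18 - (#((ipwb m).filter fun ω => visits m ω = 2) * y ^ 2 + 14 * y ^ 3) / wallRate y ^ 20 =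
      pwbVisitMean y - 1 - y ^ 2 / wallRate y ^ 12 - 3 * y ^ 2 / wallRate y ^ 14 - 11 * y ^ 2 / wallRate y ^ 16 -
        ((34 : ℕ) * y ^ 2 + 2 * y ^ 3) / wallRate y ^ 18 - (#((ipwb m).filter fun ω => visits m ω = 2) * y ^ 2 + 14 * y ^ 3) / wallRate y ^ 20 := by
    push_cast; ring
  rw [e]
  refine h.congr_fun fun j => ?_
  rw [show j + 1 + 10 = j + 11 by omega]

/-- ★★ **Lower bound** (`y > μ⁴`): `y²/β¹² + 3y²/β¹⁴ + 11y²/β¹⁶ + (34y² + 2y³)/β¹⁸ + 14y³/β²⁰ ≤ V(y) − 1` (the two-visit twenties and every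
term beyond are nonnegative). [cite: MadrasSlade1993, Section 4.2, (4.2.4)–(4.2.5) (p. 91)] [cite: Kesten1963SAW, Section 4] -/
theorem pwbVisitMean_sub_one_ge_seven (hy : hexConnectiveConstant ^ 4 < y) :
    y ^ 2 / wallRate y ^ 12 + 3 * y ^ 2 / wallRate y ^ 14 + 11 * y ^ 2 / wallRate y ^ 16 + (34 * y ^ 2 + 2 * y ^ 3) / wallRate y ^ 18 +
        14 * y ^ 3 / wallRate y ^ 20 ≤ pwbVisitMean y - 1 := by
  classical
  obtain ⟨m, hm⟩ : ∃ m : ℕ, m = 20 := ⟨_, rfl⟩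
  have hy0 : 0 ≤ y := by have := four_le_mu_four_sm; linarith
  have h := (hasSum_visitExcess_twentytwo hy hm).nonneg fun j =>
    div_nonneg (sub_nonneg.2 (IPWB_le_IPWBV _ hy0)) (pow_nonneg (wallRate_pos y).le _)
  have hN : 0 ≤ (#((ipwb m).filter fun ω => visits m ω = 2) : ℝ) * y ^ 2 / wallRate y ^ 20 :=
    div_nonneg (by positivity) (pow_nonneg (wallRate_pos y).le _)
  have e : (#((ipwb m).filter fun ω => visits m ω = 2) * y ^ 2 + 14 * y ^ 3) / wallRate y ^ 20 =
      (#((ipwb m).filter fun ω => visits m ω = 2) : ℝ) * y ^ 2 / wallRate y ^ 20 + 14 * y ^ 3 / wallRate y ^ 20 := by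
    rw [add_div]
  rw [e] at h
  linarith

/-- ★★ **Upper bound** (`y ≥ 48`): `V(y) − 1 ≤ y²/β¹² + 3y²/β¹⁴ + 11y²/β¹⁶ + (34y² + 2y³)/β¹⁸ + 14y³/β²⁰ + 1360811755669077/y⁸ + 16 μ³⁴/(y⁷√y)` —
the two-visit twenties (`N₁₀,₂ ≤ 9¹⁰`, `y²/β²⁰ ≤ 1/y⁸`), the five census-unknown terms `s = 11, …, 15` (`Σ (s − 9)9^s = 1360808268884676`)
and HALF of the mean's tail `Σ_{s ≥ 16}(s − 1)f_s ≤ 32μ³⁴/(y⁷√y)` (entropy: `Λ^v − Λ ≤ ((s−1)/2)Λ`).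
[cite: MadrasSlade1993, Section 4.2, (4.2.4)–(4.2.5), Theorem 4.2.2 and remark before (4.2.21) (pp. 91–94)] [cite: Kesten1963SAW, Section 4] -/
theorem pwbVisitMean_sub_one_le_seven (hy : 48 ≤ y) :
    pwbVisitMean y - 1 ≤ y ^ 2 / wallRate y ^ 12 + 3 * y ^ 2 / wallRate y ^ 14 + 11 * y ^ 2 / wallRate y ^ 16 +
      (34 * y ^ 2 + 2 * y ^ 3) / wallRate y ^ 18 + 14 * y ^ 3 / wallRate y ^ 20 +
      1360811755669077 / y ^ 8 + 16 * hexConnectiveConstant ^ 34 / (y ^ 7 * Real.sqrt y) := by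
  classical
  obtain ⟨m, hm⟩ : ∃ m : ℕ, m = 20 := ⟨_, rfl⟩
  have hy0 : 0 < y := by linarith
  have hy1 : 1 ≤ y := by linarith
  have hμ : hexConnectiveConstant ^ 4 < y := mu_four_lt_twelve_sm.trans_le (by linarith)
  have h := (hasSum_nat_add_iff' 5).2 (hasSum_visitExcess_twentytwo hμ hm)
  have hT := hasSum_excess_tail_sixteen hμ
  have hTle := excess_tail_sixteen_le hy
  have hle : ∀ j : ℕ, (IPWBV (2 * (j + 5 + 11)) y - IPWB (2 * (j + 5 + 11)) y) / wallRate y ^ (2 * (j + 5 + 11)) ≤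
      1 / 2 * (((j : ℝ) + 15) * pwbLaw y (j + 16)) := by
    intro j
    have h1 := IPWBV_sub_IPWB_le_mul (j + 5 + 11) hy0.le
    have hβ : 0 < wallRate y ^ (2 * (j + 5 + 11)) := pow_pos (wallRate_pos y) _
    rw [pwbLaw, show j + 16 = j + 5 + 11 by omega]
    calc (IPWBV (2 * (j + 5 + 11)) y - IPWB (2 * (j + 5 + 11)) y) / wallRate y ^ (2 * (j + 5 + 11))
        ≤ (((j + 5 + 11 : ℕ) : ℝ) - 1) / 2 * IPWB (2 * (j + 5 + 11)) y / wallRate y ^ (2 * (j + 5 + 11)) :=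
          div_le_div_of_nonneg_right h1 hβ.le
      _ = 1 / 2 * (((j : ℝ) + 15) * (IPWB (2 * (j + 5 + 11)) y / wallRate y ^ (2 * (j + 5 + 11)))) := by
          push_cast; ring
  have hsum := hasSum_le hle h (hT.mul_left (1 / 2))
  -- the five census-unknown terms
  have h11 := visitExcess_term_le_nine_pow_eight (s := 11) (by norm_num) hy1
  have h12 := visitExcess_term_le_nine_pow_eight (s := 12) (by norm_num) hy1
  have h13 := visitExcess_term_le_nine_pow_eight (s := 13) (by norm_num) hy1
  have h14 := visitExcess_term_le_nine_pow_eight (s := 14) (by norm_num) hy1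
  have h15 := visitExcess_term_le_nine_pow_eight (s := 15) (by norm_num) hy1
  have hfive : ∑ i ∈ Finset.range 5, (IPWBV (2 * (i + 11)) y - IPWB (2 * (i + 11)) y) / wallRate y ^ (2 * (i + 11)) ≤
      1360808268884676 / y ^ 8 := by
    rw [Finset.sum_range_succ, Finset.sum_range_succ, Finset.sum_range_succ, Finset.sum_range_succ, Finset.sum_range_succ,
      Finset.sum_range_zero, zero_add,
      show 2 * (0 + 11) = 2 * 11 by norm_num, show 2 * (1 + 11) = 2 * 12 by norm_num, show 2 * (2 + 11) = 2 * 13 by norm_num,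
      show 2 * (3 + 11) = 2 * 14 by norm_num, show 2 * (4 + 11) = 2 * 15 by norm_num]
    have e : (1360808268884676 : ℝ) / y ^ 8 = ((11 : ℕ) - 9 : ℝ) * 9 ^ 11 / y ^ 8 + ((12 : ℕ) - 9 : ℝ) * 9 ^ 12 / y ^ 8 +
        ((13 : ℕ) - 9 : ℝ) * 9 ^ 13 / y ^ 8 + ((14 : ℕ) - 9 : ℝ) * 9 ^ 14 / y ^ 8 + ((15 : ℕ) - 9 : ℝ) * 9 ^ 15 / y ^ 8 := by
      push_cast
      field_simp
      norm_num
    rw [e]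
    linarith
  -- the two-visit twenties: `N₁₀,₂ y²/β²⁰ ≤ 9¹⁰ y²/y¹⁰ = 3486784401/y⁸`
  have hN : (#((ipwb m).filter fun ω => visits m ω = 2) : ℝ) * y ^ 2 / wallRate y ^ 20 ≤ 3486784401 / y ^ 8 := by
    have hc : (#((ipwb m).filter fun ω => visits m ω = 2) : ℝ) ≤ 3486784401 := by
      calc (#((ipwb m).filter fun ω => visits m ω = 2) : ℝ) ≤ #(ipwb m) := by
            exact_mod_cast Finset.card_le_card (Finset.filter_subset _ _)
        _ ≤ 3 ^ m := card_ipwb_le_three_pow _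
        _ = 3486784401 := by rw [hm]; norm_num
    have hden : y ^ 10 ≤ wallRate y ^ 20 := pow_le_wallRate_pow_sm hy0 10
    calc (#((ipwb m).filter fun ω => visits m ω = 2) : ℝ) * y ^ 2 / wallRate y ^ 20 ≤ 3486784401 * y ^ 2 / wallRate y ^ 20 :=
          div_le_div_of_nonneg_right (by gcongr) (pow_nonneg (wallRate_pos y).le _)
      _ ≤ 3486784401 * y ^ 2 / y ^ 10 := div_le_div_of_nonneg_left (by positivity) (by positivity) hden
      _ = 3486784401 / y ^ 8 := by
          rw [div_eq_div_iff (by positivity) (by positivity)]; ring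
  have eN : (#((ipwb m).filter fun ω => visits m ω = 2) * y ^ 2 + 14 * y ^ 3) / wallRate y ^ 20 =
      (#((ipwb m).filter fun ω => visits m ω = 2) : ℝ) * y ^ 2 / wallRate y ^ 20 + 14 * y ^ 3 / wallRate y ^ 20 := by
    rw [add_div]
  have hhalf : 1 / 2 * (pwbMean y - 1 - (2 * pwbLaw y 3 + 3 * pwbLaw y 4 + 4 * pwbLaw y 5 + 5 * pwbLaw y 6 + 6 * pwbLaw y 7 +
      7 * pwbLaw y 8 + 8 * pwbLaw y 9 + 9 * pwbLaw y 10 + 10 * pwbLaw y 11 + 11 * pwbLaw y 12 + 12 * pwbLaw y 13 + 13 * pwbLaw y 14 +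
      14 * pwbLaw y 15)) ≤ 16 * hexConnectiveConstant ^ 34 / (y ^ 7 * Real.sqrt y) := by
    have e : 16 * hexConnectiveConstant ^ 34 / (y ^ 7 * Real.sqrt y) = 1 / 2 * (32 * hexConnectiveConstant ^ 34 / (y ^ 7 * Real.sqrt y)) := by
      ring
    rw [e]
    exact mul_le_mul_of_nonneg_left hTle (by norm_num)
  have e15 : (1360811755669077 : ℝ) / y ^ 8 = 1360808268884676 / y ^ 8 + 3486784401 / y ^ 8 := by
    rw [← add_div]; norm_num
  rw [eN] at h
  rw [e15]
  linarith

/-! ### §6  THE VISIT MEAN TO SEVENTH ORDER: `y⁷(V − 1 − y²/β¹² − 3y²/β¹⁴ − 11y²/β¹⁶ − (34y² + 2y³)/β¹⁸) → 14` and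
`V = 1 + 1/y⁴ + 3/y⁵ + 7/y⁶ + 21/y⁷ + o(y⁻⁷)` -/

/-- ★★★ **`y⁷ (V(y) − 1 − y²/β¹² − 3y²/β¹⁴ − 11y²/β¹⁶ − (34y² + 2y³)/β¹⁸) → 14`** (`y → ∞`), `14 = 2·N₁₀,₃`: the seven three-visit twenties carry
the remainder of the seventh order of the visit mean (the thirty-four two-visit eighteens and the three-visit eighteen are subtracted explicitly).
[cite: MadrasSlade1993, Section 4.2, Theorem 4.2.2 (pp. 91–92)] [cite: Kesten1963SAW, Section 4] -/
theorem tendsto_pow_seven_mul_pwbVisitMean_sub :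
    Tendsto (fun y : ℝ => y ^ 7 * (pwbVisitMean y - 1 - y ^ 2 / wallRate y ^ 12 - 3 * y ^ 2 / wallRate y ^ 14 -
      11 * y ^ 2 / wallRate y ^ 16 - (34 * y ^ 2 + 2 * y ^ 3) / wallRate y ^ 18)) atTop (𝓝 14) := by
  have hlow : Tendsto (fun y : ℝ => 14 * (y ^ 10 / wallRate y ^ 20)) atTop (𝓝 14) := by
    simpa using tendsto_pow_ten_div_wallRate_pow_twenty.const_mul 14
  have h1 : Tendsto (fun y : ℝ => (1360811755669077 : ℝ) / y) atTop (𝓝 0) := tendsto_const_nhds.div_atTop tendsto_id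
  have h2 : Tendsto (fun y : ℝ => 16 * hexConnectiveConstant ^ 34 / Real.sqrt y) atTop (𝓝 0) :=
    tendsto_const_nhds.div_atTop Real.tendsto_sqrt_atTop
  have hup : Tendsto (fun y : ℝ => 14 * (y ^ 10 / wallRate y ^ 20) + 1360811755669077 / y + 16 * hexConnectiveConstant ^ 34 / Real.sqrt y)
      atTop (𝓝 14) := by
    simpa using (hlow.add h1).add h2
  refine tendsto_of_tendsto_of_tendsto_of_le_of_le' hlow hup ?_ ?_
  · filter_upwards [eventually_gt_atTop (hexConnectiveConstant ^ 4)] with y hy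
    have hy0 : 0 < y := lt_of_le_of_lt (by positivity) hy
    have h := pwbVisitMean_sub_one_ge_seven hy
    have hle : 14 * y ^ 3 / wallRate y ^ 20 ≤
        pwbVisitMean y - 1 - y ^ 2 / wallRate y ^ 12 - 3 * y ^ 2 / wallRate y ^ 14 - 11 * y ^ 2 / wallRate y ^ 16 -
          (34 * y ^ 2 + 2 * y ^ 3) / wallRate y ^ 18 := by linarith
    have hm := mul_le_mul_of_nonneg_left hle (pow_pos hy0 7).le
    have e : y ^ 7 * (14 * y ^ 3 / wallRate y ^ 20) = 14 * (y ^ 10 / wallRate y ^ 20) := by ring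
    rw [e] at hm
    exact hm
  · filter_upwards [eventually_ge_atTop (48 : ℝ)] with y hy
    have hy0 : 0 < y := by linarith
    have h := pwbVisitMean_sub_one_le_seven hy
    have hle : pwbVisitMean y - 1 - y ^ 2 / wallRate y ^ 12 - 3 * y ^ 2 / wallRate y ^ 14 - 11 * y ^ 2 / wallRate y ^ 16 -
        (34 * y ^ 2 + 2 * y ^ 3) / wallRate y ^ 18 ≤
        14 * y ^ 3 / wallRate y ^ 20 + 1360811755669077 / y ^ 8 + 16 * hexConnectiveConstant ^ 34 / (y ^ 7 * Real.sqrt y) := by linarith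
    have hm := mul_le_mul_of_nonneg_left hle (pow_pos hy0 7).le
    have e1 : y ^ 7 * (14 * y ^ 3 / wallRate y ^ 20) = 14 * (y ^ 10 / wallRate y ^ 20) := by ring
    have e2 : y ^ 7 * (1360811755669077 / y ^ 8) = 1360811755669077 / y := by
      rw [mul_div_assoc', div_eq_div_iff (by positivity) (by positivity)]; ring
    have e3 : y ^ 7 * (16 * hexConnectiveConstant ^ 34 / (y ^ 7 * Real.sqrt y)) = 16 * hexConnectiveConstant ^ 34 / Real.sqrt y := by
      have hs : 0 < Real.sqrt y := Real.sqrt_pos.2 hy0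
      rw [mul_div_assoc', div_eq_div_iff (by positivity) (by positivity)]; ring
    calc y ^ 7 * (pwbVisitMean y - 1 - y ^ 2 / wallRate y ^ 12 - 3 * y ^ 2 / wallRate y ^ 14 - 11 * y ^ 2 / wallRate y ^ 16 -
          (34 * y ^ 2 + 2 * y ^ 3) / wallRate y ^ 18)
        ≤ y ^ 7 * (14 * y ^ 3 / wallRate y ^ 20 + 1360811755669077 / y ^ 8 + 16 * hexConnectiveConstant ^ 34 / (y ^ 7 * Real.sqrt y)) := hm
      _ = 14 * (y ^ 10 / wallRate y ^ 20) + 1360811755669077 / y + 16 * hexConnectiveConstant ^ 34 / Real.sqrt y := by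
          rw [mul_add, mul_add, e1, e2, e3]

/-- **The hooked twelve's visit term to seventh order**: `y⁷·(y²/β¹²) − y³ + 6y → −6`.
[cite: BeatonBousquetMelouDeGierDuminilCopinGuttmann2014, Section 3.1, Proposition 5 (arXiv v5 p. 9)] [cite: MadrasSlade1993, Section 4.2, (4.2.2) (p. 91)] -/
theorem tendsto_pow_seven_mul_sq_div_sub :
    Tendsto (fun y : ℝ => y ^ 7 * (y ^ 2 / wallRate y ^ 12) - 1 * y ^ 3 + 6 * y) atTop (𝓝 (-6)) := by
  have hA := tendsto_sq_mul_one_sub_div_wallRate_sq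
  have hQ := tendsto_cube_mul_one_sub_div_sub
  have hu : Tendsto (fun y : ℝ => y⁻¹) atTop (𝓝 0) := tendsto_inv_atTop_zero
  have h := ((((((hQ.const_mul ((-6) : ℝ)).add
      (((hA.pow 2).mul hu).const_mul (15 : ℝ))).add
      (((hA.pow 3).mul (hu.pow 3)).const_mul ((-20) : ℝ))).add
      (((hA.pow 4).mul (hu.pow 5)).const_mul (15 : ℝ))).add
      (((hA.pow 5).mul (hu.pow 7)).const_mul ((-6) : ℝ))).add
      ((hA.pow 6).mul (hu.pow 9)))
  refine Tendsto.congr' ?_ (tendsto_of_tendsto_of_eq_sm h (by norm_num))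
  filter_upwards [eventually_gt_atTop (0 : ℝ)] with y hy
  have hw : wallRate y ≠ 0 := (wallRate_pos y).ne'
  have hy' : y ≠ 0 := hy.ne'
  field_simp
  ring

/-- **The hooked fourteens' visit term to seventh order**: `y⁷·(3y²/β¹⁴) − 3y² → −21`.
[cite: BeatonBousquetMelouDeGierDuminilCopinGuttmann2014, Section 3.1, Proposition 5 (arXiv v5 p. 9)] [cite: MadrasSlade1993, Section 4.2, (4.2.2) (p. 91)] -/
theorem tendsto_pow_seven_mul_three_sq_div_sub :
    Tendsto (fun y : ℝ => y ^ 7 * (3 * y ^ 2 / wallRate y ^ 14) - 3 * y ^ 2) atTop (𝓝 (-21)) := by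
  have hA := tendsto_sq_mul_one_sub_div_wallRate_sq
  have hu : Tendsto (fun y : ℝ => y⁻¹) atTop (𝓝 0) := tendsto_inv_atTop_zero
  have h := (((((((hA.const_mul ((-21) : ℝ)).add
      (((hA.pow 2).mul (hu.pow 2)).const_mul (63 : ℝ))).add
      (((hA.pow 3).mul (hu.pow 4)).const_mul ((-105) : ℝ))).add
      (((hA.pow 4).mul (hu.pow 6)).const_mul (105 : ℝ))).add
      (((hA.pow 5).mul (hu.pow 8)).const_mul ((-63) : ℝ))).add
      (((hA.pow 6).mul (hu.pow 10)).const_mul (21 : ℝ))).add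
      (((hA.pow 7).mul (hu.pow 12)).const_mul ((-3) : ℝ)))
  refine Tendsto.congr' ?_ (tendsto_of_tendsto_of_eq_sm h (by norm_num))
  filter_upwards [eventually_gt_atTop (0 : ℝ)] with y hy
  have hw : wallRate y ≠ 0 := (wallRate_pos y).ne'
  have hy' : y ≠ 0 := hy.ne'
  field_simp
  ring

/-- **The two-visit sixteens' visit term to seventh order**: `y⁷·(11y²/β¹⁶) − 11y → 0`.
[cite: BeatonBousquetMelouDeGierDuminilCopinGuttmann2014, Section 3.1, Proposition 5 (arXiv v5 p. 9)] [cite: MadrasSlade1993, Section 4.2, (4.2.2) (p. 91)] -/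
theorem tendsto_pow_seven_mul_eleven_sq_div_sub :
    Tendsto (fun y : ℝ => y ^ 7 * (11 * y ^ 2 / wallRate y ^ 16) - 11 * y) atTop (𝓝 0) := by
  have hA := tendsto_sq_mul_one_sub_div_wallRate_sq
  have hu : Tendsto (fun y : ℝ => y⁻¹) atTop (𝓝 0) := tendsto_inv_atTop_zero
  have h := (((((((((hA.mul hu).const_mul ((-88) : ℝ)).add
      (((hA.pow 2).mul (hu.pow 3)).const_mul (308 : ℝ))).add
      (((hA.pow 3).mul (hu.pow 5)).const_mul ((-616) : ℝ))).add
      (((hA.pow 4).mul (hu.pow 7)).const_mul (770 : ℝ))).add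
      (((hA.pow 5).mul (hu.pow 9)).const_mul ((-616) : ℝ))).add
      (((hA.pow 6).mul (hu.pow 11)).const_mul (308 : ℝ))).add
      (((hA.pow 7).mul (hu.pow 13)).const_mul ((-88) : ℝ))).add
      (((hA.pow 8).mul (hu.pow 15)).const_mul (11 : ℝ)))
  refine Tendsto.congr' ?_ (tendsto_of_tendsto_of_eq_sm h (by norm_num))
  filter_upwards [eventually_gt_atTop (0 : ℝ)] with y hy
  have hw : wallRate y ≠ 0 := (wallRate_pos y).ne'
  have hy' : y ≠ 0 := hy.ne'
  field_simp
  ring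

/-- **The eighteens' visit terms to seventh order**: `y⁷·((34y² + 2y³)/β¹⁸) − 2y → 34` (`34 = N₉,₂`).
[cite: BeatonBousquetMelouDeGierDuminilCopinGuttmann2014, Section 3.1, Proposition 5 (arXiv v5 p. 9)] [cite: MadrasSlade1993, Section 4.2, (4.2.2) (p. 91)] -/
theorem tendsto_pow_seven_mul_eighteens_visit_sub :
    Tendsto (fun y : ℝ => y ^ 7 * ((34 * y ^ 2 + 2 * y ^ 3) / wallRate y ^ 18) - 2 * y) atTop (𝓝 34) := by
  have hA := tendsto_sq_mul_one_sub_div_wallRate_sq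
  have hu : Tendsto (fun y : ℝ => y⁻¹) atTop (𝓝 0) := tendsto_inv_atTop_zero
  have h := (((((((((((((((((((tendsto_const_nhds (x := (34 : ℝ))).add
      ((hA.mul hu).const_mul ((-18) : ℝ))).add
      ((hA.mul (hu.pow 2)).const_mul ((-306) : ℝ))).add
      (((hA.pow 2).mul (hu.pow 3)).const_mul (72 : ℝ))).add
      (((hA.pow 2).mul (hu.pow 4)).const_mul (1224 : ℝ))).add
      (((hA.pow 3).mul (hu.pow 5)).const_mul ((-168) : ℝ))).add
      (((hA.pow 3).mul (hu.pow 6)).const_mul ((-2856) : ℝ))).add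
      (((hA.pow 4).mul (hu.pow 7)).const_mul (252 : ℝ))).add
      (((hA.pow 4).mul (hu.pow 8)).const_mul (4284 : ℝ))).add
      (((hA.pow 5).mul (hu.pow 9)).const_mul ((-252) : ℝ))).add
      (((hA.pow 5).mul (hu.pow 10)).const_mul ((-4284) : ℝ))).add
      (((hA.pow 6).mul (hu.pow 11)).const_mul (168 : ℝ))).add
      (((hA.pow 6).mul (hu.pow 12)).const_mul (2856 : ℝ))).add
      (((hA.pow 7).mul (hu.pow 13)).const_mul ((-72) : ℝ))).add
      (((hA.pow 7).mul (hu.pow 14)).const_mul ((-1224) : ℝ))).add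
      (((hA.pow 8).mul (hu.pow 15)).const_mul (18 : ℝ))).add
      (((hA.pow 8).mul (hu.pow 16)).const_mul (306 : ℝ))).add
      (((hA.pow 9).mul (hu.pow 17)).const_mul ((-2) : ℝ))).add
      (((hA.pow 9).mul (hu.pow 18)).const_mul ((-34) : ℝ)))
  refine Tendsto.congr' ?_ (tendsto_of_tendsto_of_eq_sm h (by norm_num))
  filter_upwards [eventually_gt_atTop (0 : ℝ)] with y hy
  have hw : wallRate y ≠ 0 := (wallRate_pos y).ne'
  have hy' : y ≠ 0 := hy.ne'
  field_simp
  ring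

/-- ★★★ **`y⁷ (V(y) − 1 − 1/y⁴ − 3/y⁵ − 7/y⁶) → 21`**, i.e. **`V(y) = 1 + 1/y⁴ + 3/y⁵ + 7/y⁶ + 21/y⁷ + o(y⁻⁷)`** (`y → ∞`): `21 = 14 − 6 − 21 + 0 + 34`
(the three-visit twenties twice, the hooked twelve's, the hooked fourteens' and the two-visit sixteens' own corrections, the thirty-four two-visit eighteens).
[cite: MadrasSlade1993, Section 4.2, Theorem 4.2.2 (pp. 91–92)] [cite: Kesten1963SAW, Section 4] [cite: JansevanRensburgWhittington2013, Section 3.1] -/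
theorem tendsto_pow_seven_mul_pwbVisitMean_sub_one_sub :
    Tendsto (fun y : ℝ => y ^ 7 * (pwbVisitMean y - 1 - 1 / y ^ 4 - 3 / y ^ 5 - 7 / y ^ 6)) atTop (𝓝 21) := by
  have h := (((tendsto_pow_seven_mul_pwbVisitMean_sub.add tendsto_pow_seven_mul_sq_div_sub).add tendsto_pow_seven_mul_three_sq_div_sub).add
    tendsto_pow_seven_mul_eleven_sq_div_sub).add tendsto_pow_seven_mul_eighteens_visit_sub
  refine Tendsto.congr' ?_ (tendsto_of_tendsto_of_eq_sm h (by norm_num))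
  filter_upwards [eventually_gt_atTop (0 : ℝ)] with y hy
  have hy' : y ≠ 0 := hy.ne'
  have hw : wallRate y ≠ 0 := (wallRate_pos y).ne'
  field_simp
  ring

/-- ★ **Asymptotic equivalence** `V(y) − 1 − 1/y⁴ − 3/y⁵ − 7/y⁶ ∼ 21/y⁷`. [cite: MadrasSlade1993, Section 4.2, Theorem 4.2.2 (pp. 91–92)] [cite: JansevanRensburgWhittington2013, Section 3.1] -/
theorem isEquivalent_pwbVisitMean_sub_one_sub_seven :
    (fun y : ℝ => pwbVisitMean y - 1 - 1 / y ^ 4 - 3 / y ^ 5 - 7 / y ^ 6) ~[atTop] fun y : ℝ => 21 / y ^ 7 := by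
  have hz : ∀ᶠ y : ℝ in atTop, (21 : ℝ) / y ^ 7 ≠ 0 := by
    filter_upwards [eventually_gt_atTop (0 : ℝ)] with y hy
    positivity
  refine (isEquivalent_iff_tendsto_one hz).2 ?_
  have h := tendsto_pow_seven_mul_pwbVisitMean_sub_one_sub.div_const 21
  rw [show ((21 : ℝ) / 21) = 1 by norm_num] at h
  refine h.congr' ?_
  filter_upwards [eventually_gt_atTop (0 : ℝ)] with y hy
  simp only [Pi.div_apply]
  rw [div_div_eq_mul_div]
  ring

/-! ### §7  THE CONTACT DENSITY TO SEVENTH ORDER: `½ − ρ(log y) = 1/y² + 3/(2y³) + 3/y⁴ + 15/(2y⁵) + 23/(2y⁶) + 49/(2y⁷) + o(y⁻⁷)` -/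

/-- ★★★ **`y⁷ (½ − ρ⁺(log y) − 1/y² − 3/(2y³) − 3/y⁴ − 15/(2y⁵) − 23/(2y⁶)) → 49/2`** (`y → ∞`): the SEVENTH coefficient of the strong-adsorption
expansion of the surface contact density — by `½ − ρ⁺ = (m − V)/(2m)` and the pure forms of `m` (→ 211) and `V` (→ 21):
`49/2 = (211 − 21 − 2·30 − 3·11 − 6·3 − 15·2 − 23·0)/2`.  Hence **`½ − ρ(log y) = 1/y² + 3/(2y³) + 3/y⁴ + 15/(2y⁵) + 23/(2y⁶) + 49/(2y⁷) + o(y⁻⁷)`**.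
[cite: Giacomin2011, Chapter 2, eq. (2.11)] [cite: BeatonBousquetMelouDeGierDuminilCopinGuttmann2014, Section 3.1, Proposition 5 (arXiv v5 p. 9) and p. 10]
[cite: JansevanRensburgWhittington2013, Section 3.1] [cite: MadrasSlade1993, Section 4.2, Theorem 4.2.2 (pp. 91–92)] -/
theorem tendsto_pow_seven_mul_density_deficit :
    Tendsto (fun y : ℝ => y ^ 7 * (1 / 2 - wallRightDensity (Real.log y) - 1 / y ^ 2 - 3 / (2 * y ^ 3) - 3 / y ^ 4 - 15 / (2 * y ^ 5) -
      23 / (2 * y ^ 6))) atTop (𝓝 (49 / 2)) := by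
  have hA := tendsto_pow_seven_mul_pwbMean_sub_six_terms
  have hB := tendsto_pow_seven_mul_pwbVisitMean_sub_one_sub
  have hC5 := tendsto_pow_five_mul_pwbMean_sub_four_terms
  have hC4 := tendsto_pow_four_mul_pwbMean_sub_one_sub_sub
  have hC3 := tendsto_cube_mul_pwbMean_sub_one_sub_two_div_sq
  have hD := tendsto_sq_mul_pwbMean_sub_one
  have hE := tendsto_mul_pwbMean_sub_one_sm
  have hm := tendsto_pwbMean_sm
  have h := ((((((hA.sub hB).sub (hC5.const_mul 2)).sub (hC4.const_mul 3)).sub (hC3.const_mul 6)).sub (hD.const_mul 15)).sub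
    (hE.const_mul 23)).div (hm.const_mul 2) (by norm_num)
  refine Tendsto.congr' ?_ (tendsto_of_tendsto_of_eq_sm h (by norm_num))
  filter_upwards [eventually_gt_atTop (hexConnectiveConstant ^ 4)] with y hy
  have hy0 : 0 < y := lt_of_le_of_lt (by positivity) hy
  have hm0 : pwbMean y ≠ 0 := (pwbMean_pos hy).ne'
  have hid := pwbMean_sub_pwbVisitMean_eq hy
  have hy' : y ≠ 0 := hy0.ne'
  simp only [Pi.div_apply]
  rw [div_eq_iff (mul_ne_zero two_ne_zero hm0)]
  have e2 : y ^ 7 * (1 / 2 - wallRightDensity (Real.log y) - 1 / y ^ 2 - 3 / (2 * y ^ 3) - 3 / y ^ 4 - 15 / (2 * y ^ 5) - 23 / (2 * y ^ 6)) *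
        (2 * pwbMean y) =
      y ^ 7 * (2 * pwbMean y * (1 / 2 - wallRightDensity (Real.log y))) - 2 * pwbMean y * y ^ 5 - 3 * pwbMean y * y ^ 4 -
        6 * pwbMean y * y ^ 3 - 15 * pwbMean y * y ^ 2 - 23 * pwbMean y * y := by
    field_simp
    ring
  rw [e2, ← hid]
  field_simp
  ring

/-- ★★ **The same for the left density** (no kink on `eᵗ > μ⁴`): `y⁷ (½ − ρ⁻(log y) − 1/y² − 3/(2y³) − 3/y⁴ − 15/(2y⁵) − 23/(2y⁶)) → 49/2`.
[cite: Giacomin2011, Chapter 2, eq. (2.11)] [cite: JansevanRensburgWhittington2013, Section 3.1, eq. (3.4)] -/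
theorem tendsto_pow_seven_mul_density_deficit_left :
    Tendsto (fun y : ℝ => y ^ 7 * (1 / 2 - wallLeftDensity (Real.log y) - 1 / y ^ 2 - 3 / (2 * y ^ 3) - 3 / y ^ 4 - 15 / (2 * y ^ 5) -
      23 / (2 * y ^ 6))) atTop (𝓝 (49 / 2)) := by
  refine tendsto_pow_seven_mul_density_deficit.congr' ?_
  filter_upwards [eventually_gt_atTop (hexConnectiveConstant ^ 4)] with y hy
  have hy0 : 0 < y := lt_of_le_of_lt (by positivity) hy
  have ht : hexConnectiveConstant ^ 4 < Real.exp (Real.log y) := by rwa [Real.exp_log hy0]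
  rw [wallLeftDensity_eq_wallRightDensity ht]

/-- ★★ **`t`-form, seventh order**: `e^{7t} (½ − ρ⁺(t) − e^{−2t} − (3/2)e^{−3t} − 3e^{−4t} − (15/2)e^{−5t} − (23/2)e^{−6t}) → 49/2` (`t → ∞`).
[cite: BeatonBousquetMelouDeGierDuminilCopinGuttmann2014, Section 3.1, Proposition 5 (arXiv v5 p. 9) and p. 10] [cite: Giacomin2011, Chapter 2, eq. (2.11)] -/
theorem tendsto_exp_seven_mul_deficit :
    Tendsto (fun t : ℝ => Real.exp (7 * t) * (1 / 2 - wallRightDensity t - Real.exp (-(2 * t)) - 3 / 2 * Real.exp (-(3 * t)) -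
      3 * Real.exp (-(4 * t)) - 15 / 2 * Real.exp (-(5 * t)) - 23 / 2 * Real.exp (-(6 * t)))) atTop (𝓝 (49 / 2)) := by
  have h := tendsto_pow_seven_mul_density_deficit.comp Real.tendsto_exp_atTop
  refine h.congr' ?_
  filter_upwards [eventually_gt_atTop (0 : ℝ)] with t ht
  simp only [Function.comp_def, Real.log_exp]
  have e7 : Real.exp t ^ 7 = Real.exp (7 * t) := by rw [← Real.exp_nat_mul]; norm_num
  have e2 : (1 : ℝ) / Real.exp t ^ 2 = Real.exp (-(2 * t)) := by
    rw [Real.exp_neg, ← Real.exp_nat_mul, one_div]; norm_num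
  have e3 : (3 : ℝ) / (2 * Real.exp t ^ 3) = 3 / 2 * Real.exp (-(3 * t)) := by
    rw [Real.exp_neg, ← Real.exp_nat_mul]; push_cast; field_simp
  have e4 : (3 : ℝ) / Real.exp t ^ 4 = 3 * Real.exp (-(4 * t)) := by
    rw [Real.exp_neg, ← Real.exp_nat_mul]; push_cast; field_simp
  have e5 : (15 : ℝ) / (2 * Real.exp t ^ 5) = 15 / 2 * Real.exp (-(5 * t)) := by
    rw [Real.exp_neg, ← Real.exp_nat_mul]; push_cast; field_simp
  have e6 : (23 : ℝ) / (2 * Real.exp t ^ 6) = 23 / 2 * Real.exp (-(6 * t)) := by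
    rw [Real.exp_neg, ← Real.exp_nat_mul]; push_cast; field_simp
  rw [e7, e2, e3, e4, e5, e6]

/-- ★ **Asymptotic equivalence** `½ − ρ⁺(log y) − 1/y² − 3/(2y³) − 3/y⁴ − 15/(2y⁵) − 23/(2y⁶) ∼ 49/(2y⁷)`. [cite: Giacomin2011, Chapter 2, eq. (2.11)]
[cite: BeatonBousquetMelouDeGierDuminilCopinGuttmann2014, Section 3.1, Proposition 5 (arXiv v5 p. 9) and p. 10] -/
theorem isEquivalent_density_deficit_seventh :
    (fun y : ℝ => 1 / 2 - wallRightDensity (Real.log y) - 1 / y ^ 2 - 3 / (2 * y ^ 3) - 3 / y ^ 4 - 15 / (2 * y ^ 5) - 23 / (2 * y ^ 6)) ~[atTop]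
      fun y : ℝ => 49 / (2 * y ^ 7) := by
  have hz : ∀ᶠ y : ℝ in atTop, (49 : ℝ) / (2 * y ^ 7) ≠ 0 := by
    filter_upwards [eventually_gt_atTop (0 : ℝ)] with y hy
    positivity
  refine (isEquivalent_iff_tendsto_one hz).2 ?_
  have h := tendsto_pow_seven_mul_density_deficit.div_const (49 / 2)
  rw [show ((49 / 2 : ℝ) / (49 / 2)) = 1 by norm_num] at h
  refine h.congr' ?_
  filter_upwards [eventually_gt_atTop (0 : ℝ)] with y hy
  simp only [Pi.div_apply]
  have hy' : y ≠ 0 := hy.ne'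
  field_simp

end Literature.Probability.RandomPlanarGeometry.SAW.HexBW.Wall
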